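import Mathlib.Analysis.SpecialFunctions.PolarCoord
import Mathlib.Analysis.SpecialFunctions.Trigonometric.InverseDeriv
import Mathlib.Analysis.SpecialFunctions.Sqrt
import Mathlib.MeasureTheory.Integral.IntervalIntegral.FundThmCalculus
import Mathlib.MeasureTheory.Measure.Lebesgue.Integral
import Mathlib.Analysis.Real.Pi.Bounds
import Mathlib.MeasureTheory.Measure.Haar.Unique
import Mathlib.Analysis.SpecialFunctions.Integrals.Basic
import Literature.MathematicalPhysics.StatisticalMechanics.HardDiscVirialProofs
import HarnessLib

/-!
# The complete-star Mayer diagram of hard discs, III-a: area of the far set `E(u)` in the lens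

Fourth file towards the discharge of
`Literature.MathematicalPhysics.StatisticalMechanics.HardSphereVirial.hardDisc_B4`
([ClisbyMccoy2004, §1]). By `HardDiscStarSlices.lean`, `vol(starDisc) = 2π · vol(Wset)` with
`Wset = {(u, v) ∈ V × V : |u − v| < 1}`, `V = B(0,1) ∩ B((0,1),1)` the standard lens at distance
`1` (tips `T± = (±√3/2, 1/2)`). The files `HardDiscStarLens*.lean` compute
`vol(Wset) = |V|² − vol{(u,v) ∈ V² : |u − v| > 1} = π²/2 − (3√3/4)π + 1/2`. This file proves the
pointwise input ("Lemma E"): for `u = (a, b) ∈ V` with `a > 0`, the far set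
`E(u) = {v ∈ V : |u − v| > 1}` has area

* `0` if `|u − T₋| ≤ 1` (`volume_farSlice_near`),
* `5π/6 − √3/4 − a/2 − A(|u|)/2 − A(|u − (0,1)|)/2` if `|u − T₋| > 1` (`volume_farSlice_far`),

`A(r) = 2 arccos(r/2) − r√(1 − r²/4)` being the lens area at distance `r` — the classical
inclusion–exclusion formula for the area common to three unit discs (cf. [ClisbyMccoy2004, §4,
eq. for `A⁽³⁾`], M. J. D. Powell, Mol. Phys. 7 (1964) 591), here obtained by direct integration.

## Proof (horizontal slicing)

The slice of `E(u)` at height `t ∈ (1/2, 1)` is the interval `(−√(1−t²), a − √(1−(b−t)²))`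
(`farSlice_upper_eq`; the right half of the lens has diameter `1`, `right_boundary_close`), so
the upper half of `E(u)` has area `L(a,b) = ∫_{1/2}^{1} (a + √(1−t²) − √(1−(b−t)²))⁺ dt`, and the
lower half is the mirror image (`v₂ ↦ 1 − v₂`) of the upper half for the mirrored point
`(a, 1 − b)`. The signed slice length is positive exactly below the critical height
`t₀ = sin(β + θ)` (`u = ρ(cos β, sin β)`, `θ = arccos(ρ/2)`; it is where the unit circle about `u`
meets the left boundary arc), because `φ(t) = a√(1−t²) − bt` is antitone and `φ(t₀) = −ρ²/2`
(`slice_pos_iff`, `phi_antitone`); the fundamental theorem of calculus with the quarter-disc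
primitive `G(x) = (arcsin x + x√(1−x²))/2` evaluates `L(a,b)` (`halfLens_far`), and
`L(a,b) + L(a,1−b)` simplifies to the displayed inclusion–exclusion expression.

All results are [folklore] calculus / measure theory; sub-namespace `HardDiscStarLens`; no
definitions, no named facts.

## References

* [ClisbyMccoy2004] N. Clisby, B. M. McCoy, J. Stat. Phys. 114 (2004) 1343–1361, §4 (area of
  intersection of three circles by inclusion–exclusion, following Powell 1964).
-/

noncomputable section

open _root_.MeasureTheory _root_.Set _root_.Real intervalIntegral

namespace Literature.MathematicalPhysics.StatisticalMechanics

namespace HardDiscStarLens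

/-! ### One-variable calculus: the quarter-disc primitive `G(x) = (arcsin x + x√(1−x²))/2` -/

/-- `d/dx [(arcsin x + x√(1−x²))/2] = √(1−x²)` on `(−1, 1)`. [folklore] -/
theorem hasDerivAt_quarterDiscPrim {x : ℝ} (h1 : -1 < x) (h2 : x < 1) :
    HasDerivAt (fun x => (arcsin x + x * √(1 - x ^ 2)) / 2) (√(1 - x ^ 2)) x := by
  have hs : 0 < 1 - x ^ 2 := by nlinarith
  have hd1 : HasDerivAt (fun y : ℝ => 1 - y ^ 2) (-(2 * x)) x := by
    simpa using (hasDerivAt_pow 2 x).const_sub 1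
  have h5 := ((hasDerivAt_arcsin h1.ne' h2.ne).add
    ((hasDerivAt_id' x).mul (hd1.sqrt hs.ne'))).div_const 2
  refine h5.congr_deriv ?_
  have hsq := sq_sqrt hs.le
  have hne : √(1 - x ^ 2) ≠ 0 := (sqrt_pos.mpr hs).ne'
  field_simp
  linear_combination -hsq

/-- `d/dt [(arcsin (t − b) + (t − b)√(1−(t−b)²))/2] = √(1 − (b − t)²)` for `|t − b| < 1`. [folklore] -/
theorem hasDerivAt_quarterDiscPrim_shift {t b : ℝ} (h1 : -1 < t - b) (h2 : t - b < 1) :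
    HasDerivAt (fun t => (arcsin (t - b) + (t - b) * √(1 - (t - b) ^ 2)) / 2)
      (√(1 - (b - t) ^ 2)) t := by
  have h := HasDerivAt.comp_sub_const t b (hasDerivAt_quarterDiscPrim h1 h2)
  have he : (b - t) ^ 2 = (t - b) ^ 2 := by ring
  rw [he]
  exact h

/-- The value `G(1/2) = π/12 + √3/8`. [folklore] -/
theorem quarterDiscPrim_half : (arcsin (1 / 2 : ℝ) + 1 / 2 * √(1 - (1 / 2) ^ 2)) / 2 =
    π / 12 + √3 / 8 := by
  have h1 : arcsin (1 / 2 : ℝ) = π / 6 := by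
    rw [show (1 / 2 : ℝ) = sin (π / 6) by rw [sin_pi_div_six]]
    exact arcsin_sin (by linarith [pi_pos]) (by linarith [pi_pos])
  have h4 : √(4:ℝ) = 2 := by
    rw [show (4:ℝ) = 2 ^ 2 by norm_num, Real.sqrt_sq (by norm_num)]
  have h2 : √(1 - (1 / 2) ^ 2 : ℝ) = √3 / 2 := by
    rw [show (1 - (1 / 2) ^ 2 : ℝ) = 3 / 4 by norm_num, Real.sqrt_div (by norm_num), h4]
  rw [h1, h2]
  ring

/-! ### The half-lens integral `L(a,b) = ∫_{1/2}^{1} (a + √(1−t²) − √(1−(b−t)²))⁺ dt` -/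

/-- Sign of the horizontal-slice length: for `t ∈ (1/2, 1)`, `0 < b < 1`, `0 ≤ a`, the quantity
`a + √(1−t²) − √(1−(b−t)²)` is `> 0`, resp. `≤ 0`, iff `a² + b² + 2a√(1−t²) − 2bt` is. [folklore] -/
theorem slice_pos_iff {a b t : ℝ} (ha : 0 ≤ a) (hb0 : 0 < b) (hb1 : b < 1)
    (ht0 : 1 / 2 < t) (ht1 : t < 1) :
    (0 < a + √(1 - t ^ 2) - √(1 - (b - t) ^ 2) ↔
      0 < a ^ 2 + b ^ 2 + 2 * a * √(1 - t ^ 2) - 2 * b * t) ∧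
    (a + √(1 - t ^ 2) - √(1 - (b - t) ^ 2) ≤ 0 ↔
      a ^ 2 + b ^ 2 + 2 * a * √(1 - t ^ 2) - 2 * b * t ≤ 0) := by
  have hm : 0 < 1 - t ^ 2 := by nlinarith
  have hk : 0 < 1 - (b - t) ^ 2 := by nlinarith
  set m := √(1 - t ^ 2) with hm_def
  set k := √(1 - (b - t) ^ 2) with hk_def
  have hm0 : 0 < m := sqrt_pos.mpr hm
  have hk0 : 0 < k := sqrt_pos.mpr hk
  have hmsq : m ^ 2 = 1 - t ^ 2 := sq_sqrt hm.le
  have hksq : k ^ 2 = 1 - (b - t) ^ 2 := sq_sqrt hk.le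
  have key : (a + m) ^ 2 - k ^ 2 = a ^ 2 + b ^ 2 + 2 * a * m - 2 * b * t := by
    linear_combination hmsq - hksq
  have ham : 0 ≤ a + m := by linarith
  constructor
  · rw [show (0 < a + m - k) ↔ (k < a + m) from sub_pos, ← pow_lt_pow_iff_left₀ hk0.le ham
      two_ne_zero, ← sub_pos, key]
  · rw [show (a + m - k ≤ 0) ↔ (a + m ≤ k) from sub_nonpos, ← pow_le_pow_iff_left₀ ham hk0.le
      two_ne_zero, ← sub_nonpos, key]

/-- The auxiliary function `φ(t) = a√(1−t²) − bt` is antitone on `[0, 1]` for `a, b ≥ 0`.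
[folklore] -/
theorem phi_antitone {a b t t' : ℝ} (ha : 0 ≤ a) (hb : 0 ≤ b) (ht : 0 ≤ t) (htt' : t ≤ t') :
    a * √(1 - t' ^ 2) - b * t' ≤ a * √(1 - t ^ 2) - b * t := by
  have h1 : √(1 - t' ^ 2) ≤ √(1 - t ^ 2) := sqrt_le_sqrt (by nlinarith)
  nlinarith [mul_le_mul_of_nonneg_left h1 ha]

/-- **Half-lens integral, near case.** If `u = (a, b)` (`a ≥ 0`, `u` in the lens) is within distance
`1` of the far tip `(−√3/2, 1/2)`, every horizontal slice above height `1/2` has nonpositive signed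
length, so `L(a, b) = 0`. [folklore] -/
theorem halfLens_near {a b : ℝ} (ha : 0 ≤ a) (hV0 : a ^ 2 + b ^ 2 < 1)
    (hV1 : a ^ 2 + (b - 1) ^ 2 < 1) (hnear : (a + √3 / 2) ^ 2 + (b - 1 / 2) ^ 2 ≤ 1) :
    ∫⁻ t in Ioo (1 / 2 : ℝ) 1, ENNReal.ofReal (a + √(1 - t ^ 2) - √(1 - (b - t) ^ 2)) = 0 := by
  have hb0 : 0 < b := by nlinarith
  have hb1 : b < 1 := by nlinarith
  have h34 : √(1 - (1 / 2) ^ 2 : ℝ) = √3 / 2 := by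
    have h4 : √(4:ℝ) = 2 := by
      rw [show (4:ℝ) = 2 ^ 2 by norm_num, Real.sqrt_sq (by norm_num)]
    rw [show (1 - (1 / 2) ^ 2 : ℝ) = 3 / 4 by norm_num, Real.sqrt_div (by norm_num), h4]
  -- `φ(1/2) ≤ −ρ²/2`
  have hphi : a ^ 2 + b ^ 2 + 2 * a * √(1 - (1 / 2) ^ 2) - 2 * b * (1 / 2) ≤ 0 := by
    rw [h34]
    have h3 : √3 ^ 2 = 3 := sq_sqrt (by norm_num)
    nlinarith
  refine (lintegral_eq_zero_iff' ?_).mpr ?_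
  · exact (ENNReal.measurable_ofReal.comp (by fun_prop)).aemeasurable
  · filter_upwards [ae_restrict_mem measurableSet_Ioo] with t ht
    have hle : a + √(1 - t ^ 2) - √(1 - (b - t) ^ 2) ≤ 0 := by
      refine ((slice_pos_iff ha hb0 hb1 ht.1 ht.2).2).mpr ?_
      have hmono := phi_antitone ha hb0.le (by norm_num : (0:ℝ) ≤ 1 / 2) ht.1.le
      linarith
    simp only [Pi.zero_apply, ENNReal.ofReal_eq_zero]
    exact hle

/-- **Half-lens integral, far case.** If `u = (a, b)` (`a > 0`, `u` in the lens `V`) is at distance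
`> 1` from the far tip `(−√3/2, 1/2)`, then with `ρ = |u|`, `θ = arccos(ρ/2)`, `β = arcsin(b/ρ)`,
`t₀ = sin(β + θ) ∈ (1/2, 1)`, the signed slice length `a + √(1−t²) − √(1−(b−t)²)` is positive on
`(1/2, t₀)` and nonpositive on `[t₀, 1)`, and the fundamental theorem of calculus gives
`L(a,b) = π/2 − A(ρ)/2 + ab/2 − a/2 − G(1/2) + G(1/2 − b)` (`A` the lens area, `G` the quarter-disc
primitive); this value is `≥ 0`. [folklore] -/
theorem halfLens_far {a b : ℝ} (ha : 0 < a) (hV0 : a ^ 2 + b ^ 2 < 1)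
    (hV1 : a ^ 2 + (b - 1) ^ 2 < 1) (hfar : 1 < (a + √3 / 2) ^ 2 + (b - 1 / 2) ^ 2) :
    ∫⁻ t in Ioo (1 / 2 : ℝ) 1, ENNReal.ofReal (a + √(1 - t ^ 2) - √(1 - (b - t) ^ 2)) =
      ENNReal.ofReal (π / 2 - (2 * arccos (√(a ^ 2 + b ^ 2) / 2) -
        √(a ^ 2 + b ^ 2) * √(1 - √(a ^ 2 + b ^ 2) ^ 2 / 4)) / 2 + a * b / 2 - a / 2
        - (π / 12 + √3 / 8) + (arcsin (1 / 2 - b) + (1 / 2 - b) * √(1 - (1 / 2 - b) ^ 2)) / 2) ∧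
    0 ≤ π / 2 - (2 * arccos (√(a ^ 2 + b ^ 2) / 2) -
        √(a ^ 2 + b ^ 2) * √(1 - √(a ^ 2 + b ^ 2) ^ 2 / 4)) / 2 + a * b / 2 - a / 2
        - (π / 12 + √3 / 8) + (arcsin (1 / 2 - b) + (1 / 2 - b) * √(1 - (1 / 2 - b) ^ 2)) / 2 := by
  -- Heartbeat budget: the side conditions below use `linarith only […]` on purpose; with bare
  -- `linarith`/`nlinarith` over the large trigonometric context this proof sat at the 200000
  -- `maxHeartbeats` limit (full-build breakage 2026-08-16), now at about a quarter of it.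
  have hb0 : 0 < b := by linarith only [hV1, sq_nonneg a, sq_nonneg b]
  have hb1 : b < 1 := by linarith only [hV0, sq_nonneg a, sq_nonneg (b - 1)]
  have hab : 0 < a ^ 2 + b ^ 2 := by positivity
  -- polar data of `u`
  set ρ := √(a ^ 2 + b ^ 2) with hρ_def
  have hρpos : 0 < ρ := sqrt_pos.mpr hab
  have hρsq : ρ ^ 2 = a ^ 2 + b ^ 2 := sq_sqrt hab.le
  have hρ1 : ρ < 1 := by
    rw [hρ_def, show (1:ℝ) = √1 by simp]
    exact sqrt_lt_sqrt hab.le (by simpa using hV0)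
  have hbρ : b < ρ :=
    lt_of_pow_lt_pow_left₀ 2 hρpos.le (by rw [hρsq]; linarith only [sq_pos_of_pos ha])
  set θ := arccos (ρ / 2) with hθ_def
  have hcosθ : cos θ = ρ / 2 := cos_arccos (by linarith only [hρpos]) (by linarith only [hρ1])
  have hρθ : ρ = 2 * cos θ := by linarith only [hcosθ]
  have hsinθ : sin θ = √(1 - ρ ^ 2 / 4) := by
    rw [hθ_def, sin_arccos]; congr 1; ring
  have hθ1 : π / 3 < θ := by
    rw [hθ_def, show π / 3 = arccos (1 / 2) by
      rw [show (1:ℝ) / 2 = cos (π / 3) by rw [cos_pi_div_three], arccos_cos (by positivity)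
        (by linarith only [pi_pos])]]
    exact strictAntiOn_arccos ⟨by linarith only [hρpos], by linarith only [hρ1]⟩
      ⟨by norm_num, by norm_num⟩ (by linarith only [hρ1])
  have hθ2 : θ < π / 2 := arccos_lt_pi_div_two.mpr (half_pos hρpos)
  have hsinθ_pos : 0 < sin θ :=
    sin_pos_of_pos_of_lt_pi (by linarith only [hθ1, hθ2]) (by linarith only [hθ1, hθ2])
  set β := arcsin (b / ρ) with hβ_def
  have hbρ0 : 0 < b / ρ := div_pos hb0 hρpos
  have hbρ1 : b / ρ < 1 := (div_lt_one hρpos).mpr hbρ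
  have hsinβ : sin β = b / ρ := sin_arcsin (by linarith only [hbρ0]) hbρ1.le
  have hcosβ : cos β = a / ρ := by
    rw [hβ_def, cos_arcsin]
    rw [show 1 - (b / ρ) ^ 2 = (a / ρ) ^ 2 by field_simp; linarith only [hρsq]]
    exact sqrt_sq (div_pos ha hρpos).le
  have hβ0 : 0 < β := arcsin_pos.mpr hbρ0
  have hβ2 : β < π / 2 := arcsin_lt_pi_div_two.mpr hbρ1
  have ha' : a = ρ * cos β := by rw [hcosβ]; field_simp
  have hb' : b = ρ * sin β := by rw [hsinβ]; field_simp
  -- (i) `π/2 − θ < β` (u lies in the disc about `(0,1)`)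
  have hF1 : π / 2 - θ < β := by
    have h1 : sin (π / 2 - θ) < sin β := by
      rw [sin_pi_div_two_sub, hcosθ, hsinβ, lt_div_iff₀ hρpos]
      linarith only [hρsq, hV1]
    exact (strictMonoOn_sin.lt_iff_lt ⟨by linarith only [hθ1, hθ2], by linarith only [hθ1, hθ2]⟩
      ⟨by linarith only [hβ0, hβ2], hβ2.le⟩).mp h1
  -- (ii) `β + θ < 5π/6` (u is far from the tip)
  have hF2 : β + θ < 5 * π / 6 := by
    have h3 : √3 ^ 2 = 3 := sq_sqrt (by norm_num)
    have hc : cos (π - θ) < cos (β + π / 6) := by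
      rw [cos_pi_sub, hcosθ, cos_add, cos_pi_div_six, sin_pi_div_six, hcosβ, hsinβ]
      rw [show a / ρ * (√3 / 2) - b / ρ * (1 / 2) = (√3 * a - b) / (2 * ρ) by field_simp,
        lt_div_iff₀ (mul_pos two_pos hρpos)]
      linarith only [hfar, h3, hρsq]
    have := (strictAntiOn_cos.lt_iff_gt (a := π - θ) (b := β + π / 6)
      ⟨by linarith only [hθ1, hθ2], by linarith only [hθ1, hθ2]⟩
      ⟨by linarith only [hβ0, hβ2], by linarith only [hβ0, hβ2]⟩).mp hc
    linarith only [this]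
  -- the critical height `t₀`
  set t₀ := sin (β + θ) with ht₀_def
  have hsum1 : π / 2 < β + θ := by linarith only [hF1]
  have hsum2 : β + θ < π := by linarith only [hF2, hβ0, hβ2]
  have ht₀_eq : t₀ = sin (π - (β + θ)) := by rw [sin_pi_sub]
  have ht₀half : 1 / 2 < t₀ := by
    rw [ht₀_eq, ← sin_pi_div_six]
    exact strictMonoOn_sin ⟨by linarith only [pi_pos], by linarith only [pi_pos]⟩
      ⟨by linarith only [hsum2, pi_pos], by linarith only [hsum1]⟩ (by linarith only [hF2])
  have ht₀one : t₀ < 1 := by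
    rw [ht₀_eq, ← sin_pi_div_two]
    exact strictMonoOn_sin ⟨by linarith only [hsum2, pi_pos], by linarith only [hsum1]⟩
      ⟨by linarith only [pi_pos], le_rfl⟩ (by linarith only [hsum1])
  have hcos_neg : cos (β + θ) < 0 :=
    cos_neg_of_pi_div_two_lt_of_lt hsum1 (by linarith only [hsum2, pi_pos])
  have hsqrt_t₀ : √(1 - t₀ ^ 2) = -cos (β + θ) := by
    rw [ht₀_def, ← cos_sq', sqrt_sq_eq_abs, abs_of_neg hcos_neg]
  have harcsin_t₀ : arcsin t₀ = π - (β + θ) := by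
    rw [ht₀_eq]; exact arcsin_sin (by linarith only [hsum2, pi_pos]) (by linarith only [hsum1])
  have ht₀b : t₀ - b = sin (θ - β) := by
    rw [ht₀_def, hb', sin_add, sin_sub, hρθ]; ring
  have hθβ1 : -(π / 2) < θ - β := by linarith only [hθ1, hθ2, hβ2]
  have hθβ2 : θ - β < π / 2 := by linarith only [hθ2, hβ0]
  have harcsin_t₀b : arcsin (t₀ - b) = θ - β := by
    rw [ht₀b]; exact arcsin_sin hθβ1.le hθβ2.le
  have hcos_pos : 0 < cos (θ - β) := cos_pos_of_mem_Ioo ⟨hθβ1, hθβ2⟩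
  have hsqrt_t₀b : √(1 - (t₀ - b) ^ 2) = cos (θ - β) := by
    rw [ht₀b, ← cos_sq', sqrt_sq hcos_pos.le]
  -- `φ(t₀) = −ρ²/2`
  have hphi_t₀ : a * √(1 - t₀ ^ 2) - b * t₀ = -(a ^ 2 + b ^ 2) / 2 := by
    rw [hsqrt_t₀, ht₀_def, ha', hb', cos_add, sin_add]
    linear_combination (ρ / 2 * (cos β ^ 2 + sin β ^ 2)) * hρθ
  -- sign of the slice length below and above `t₀`
  have hpos : ∀ t ∈ Ioo (1 / 2 : ℝ) t₀, 0 < a + √(1 - t ^ 2) - √(1 - (b - t) ^ 2) := by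
    intro t ht
    refine ((slice_pos_iff ha.le hb0 hb1 ht.1 (ht.2.trans ht₀one)).1).mpr ?_
    have ht2 : t ^ 2 ≤ t₀ ^ 2 := pow_le_pow_left₀ (by linarith only [ht.1]) ht.2.le 2
    have h1 : √(1 - t₀ ^ 2) ≤ √(1 - t ^ 2) := sqrt_le_sqrt (by linarith only [ht2])
    have hA := mul_le_mul_of_nonneg_left h1 ha.le
    have hB := mul_lt_mul_of_pos_left ht.2 hb0
    linarith only [hA, hB, hphi_t₀]
  have hnonpos : ∀ t ∈ Ico t₀ 1, a + √(1 - t ^ 2) - √(1 - (b - t) ^ 2) ≤ 0 := by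
    intro t ht
    refine ((slice_pos_iff ha.le hb0 hb1 (ht₀half.trans_le ht.1) ht.2).2).mpr ?_
    have ht2 : t₀ ^ 2 ≤ t ^ 2 := pow_le_pow_left₀ (by linarith only [ht₀half]) ht.1 2
    have h1 : √(1 - t ^ 2) ≤ √(1 - t₀ ^ 2) := sqrt_le_sqrt (by linarith only [ht2])
    have hA := mul_le_mul_of_nonneg_left h1 ha.le
    have hB := mul_le_mul_of_nonneg_left ht.1 hb0.le
    linarith only [hA, hB, hphi_t₀]
  -- the integral over `(1/2, t₀)`, by the fundamental theorem of calculus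
  have hderiv : ∀ t ∈ Ioo (1 / 2 : ℝ) t₀, HasDerivAt (fun t => a * t +
      (arcsin t + t * √(1 - t ^ 2)) / 2 - (arcsin (t - b) + (t - b) * √(1 - (t - b) ^ 2)) / 2)
      (a + √(1 - t ^ 2) - √(1 - (b - t) ^ 2)) t := by
    intro t ht
    have h1 := hasDerivAt_quarterDiscPrim (x := t) (by linarith only [ht.1]) (ht.2.trans ht₀one)
    have h2 := hasDerivAt_quarterDiscPrim_shift (t := t) (b := b) (by linarith only [ht.1, hb1])
      (by linarith only [ht.2.trans ht₀one, hb0])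
    refine ((((hasDerivAt_id' t).const_mul a).fun_add h1).fun_sub h2).congr_deriv ?_
    ring
  have hcont : ContinuousOn (fun t => a * t +
      (arcsin t + t * √(1 - t ^ 2)) / 2 - (arcsin (t - b) + (t - b) * √(1 - (t - b) ^ 2)) / 2)
      (Icc (1 / 2) t₀) := Continuous.continuousOn (by fun_prop)
  have hint : IntervalIntegrable (fun t => a + √(1 - t ^ 2) - √(1 - (b - t) ^ 2)) volume
      (1 / 2) t₀ := Continuous.intervalIntegrable (by fun_prop) _ _
  have hw : √(1 - ρ ^ 2 / 4) = sin θ := hsinθ.symm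
  have hI : ∫ t in (1 / 2 : ℝ)..t₀, (a + √(1 - t ^ 2) - √(1 - (b - t) ^ 2)) =
      π / 2 - (2 * arccos (ρ / 2) - ρ * √(1 - ρ ^ 2 / 4)) / 2 + a * b / 2 - a / 2
        - (π / 12 + √3 / 8) + (arcsin (1 / 2 - b) + (1 / 2 - b) * √(1 - (1 / 2 - b) ^ 2)) / 2 := by
    rw [integral_eq_sub_of_hasDerivAt_of_le ht₀half.le hcont hderiv hint, harcsin_t₀, hsqrt_t₀,
      harcsin_t₀b, hsqrt_t₀b, quarterDiscPrim_half, hw, ← hθ_def]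
    rw [ht₀_def, ha', hb', hρθ, sin_add, cos_add, cos_sub]
    have hpy := sin_sq_add_cos_sq β
    linear_combination (cos θ * sin θ) * hpy
  -- nonnegativity of the value
  have hInn : 0 ≤ ∫ t in (1 / 2 : ℝ)..t₀, (a + √(1 - t ^ 2) - √(1 - (b - t) ^ 2)) := by
    rw [intervalIntegral.integral_of_le ht₀half.le, integral_Ioc_eq_integral_Ioo]
    exact setIntegral_nonneg measurableSet_Ioo (fun t ht => (hpos t ht).le)
  refine ⟨?_, hI ▸ hInn⟩
  -- split the Lebesgue integral at `t₀`
  have hdisj : Disjoint (Ioo (1 / 2 : ℝ) t₀) (Ico t₀ 1) :=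
    Set.disjoint_left.mpr (fun t ht ht' => ht.2.not_ge ht'.1)
  have hunion : Ioo (1 / 2 : ℝ) 1 = Ioo (1 / 2) t₀ ∪ Ico t₀ 1 :=
    (Ioo_union_Ico_eq_Ioo ht₀half ht₀one.le).symm
  rw [hunion, lintegral_union measurableSet_Ico hdisj]
  have hzero : ∫⁻ t in Ico t₀ 1, ENNReal.ofReal (a + √(1 - t ^ 2) - √(1 - (b - t) ^ 2)) = 0 := by
    refine (lintegral_eq_zero_iff' ?_).mpr ?_
    · exact (ENNReal.measurable_ofReal.comp (by fun_prop)).aemeasurable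
    · filter_upwards [ae_restrict_mem measurableSet_Ico] with t ht
      simp only [Pi.zero_apply, ENNReal.ofReal_eq_zero]
      exact hnonpos t ht
  rw [hzero, add_zero]
  have hint' : IntegrableOn (fun t => a + √(1 - t ^ 2) - √(1 - (b - t) ^ 2)) (Ioo (1 / 2) t₀)
      volume := (Continuous.integrableOn_Icc (by fun_prop)).mono_set Ioo_subset_Icc_self
  have hnn : 0 ≤ᵐ[volume.restrict (Ioo (1 / 2 : ℝ) t₀)]
      fun t => a + √(1 - t ^ 2) - √(1 - (b - t) ^ 2) := by
    filter_upwards [ae_restrict_mem measurableSet_Ioo] with t ht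
    exact (hpos t ht).le
  rw [← ofReal_integral_eq_lintegral_ofReal hint' hnn, ← integral_Ioc_eq_integral_Ioo,
    ← intervalIntegral.integral_of_le ht₀half.le, hI]

/-! ### Geometry of the far set `E(u) = {v ∈ V : |u − v| > 1}` : horizontal slices -/

/-- The right half of the closed lens has diameter `≤ 1` in the form needed here: for `u = (a, b)`
in the lens with `a ≥ 0` and `t ∈ [1/2, 1)`, the right boundary point `(√(1−t²), t)` is within
distance `1` of `u`, i.e. `a − √(1 − (b−t)²) ≤ √(1 − t²)`. [folklore] -/
theorem right_boundary_close {a b t : ℝ} (ha : 0 ≤ a) (hV0 : a ^ 2 + b ^ 2 < 1)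
    (hV1 : a ^ 2 + (b - 1) ^ 2 < 1) (ht0 : 1 / 2 ≤ t) (ht1 : t < 1) :
    a - √(1 - (b - t) ^ 2) ≤ √(1 - t ^ 2) := by
  have hb0 : 0 < b := by nlinarith
  have hb1 : b < 1 := by nlinarith
  set c := √(1 - t ^ 2) with hc_def
  have hc0 : 0 ≤ c := sqrt_nonneg _
  have hcsq : c ^ 2 = 1 - t ^ 2 := sq_sqrt (by nlinarith)
  have key : a ^ 2 + b ^ 2 ≤ 2 * a * c + 2 * b * t := by
    rcases le_or_gt a c with hac | hac
    · nlinarith [mul_nonneg ha hc0, mul_le_mul_of_nonneg_left hac ha]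
    · rcases le_or_gt t b with htb | htb
      · nlinarith [mul_le_mul_of_nonneg_left htb hb0.le]
      · nlinarith [mul_pos (sub_pos.mpr ht1) (show 0 < 1 + t - b by linarith),
          mul_le_mul_of_nonneg_left hac.le hc0]
  have h2 : (a - c) ^ 2 ≤ 1 - (b - t) ^ 2 := by nlinarith
  have h3 : a - c ≤ √(1 - (b - t) ^ 2) :=
    calc a - c ≤ |a - c| := le_abs_self _
      _ = √((a - c) ^ 2) := (sqrt_sq_eq_abs _).symm
      _ ≤ √(1 - (b - t) ^ 2) := sqrt_le_sqrt h2
  linarith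

/-- The upper half (`v₂ > 1/2`) of the far set `E(u)`, `u = (a,b)` in the lens with `a ≥ 0`, is the
region between the graphs `v₁ = −√(1−v₂²)` (left boundary of the lens) and
`v₁ = a − √(1 − (b − v₂)²)` (left half of the unit circle about `u`) over `v₂ ∈ (1/2, 1)`
(coordinates swapped). [folklore] -/
theorem farSlice_upper_eq {a b : ℝ} (ha : 0 ≤ a) (hV0 : a ^ 2 + b ^ 2 < 1)
    (hV1 : a ^ 2 + (b - 1) ^ 2 < 1) :
    {v : ℝ × ℝ | (v.1 ^ 2 + v.2 ^ 2 < 1 ∧ v.1 ^ 2 + (v.2 - 1) ^ 2 < 1) ∧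
      1 < (a - v.1) ^ 2 + (b - v.2) ^ 2 ∧ 1 / 2 < v.2} =
    Prod.swap ⁻¹' regionBetween (fun t => -√(1 - t ^ 2)) (fun t => a - √(1 - (b - t) ^ 2))
      (Ioo (1 / 2) 1) := by
  have hb0 : 0 < b := by nlinarith
  have hb1 : b < 1 := by nlinarith
  ext v
  simp only [mem_setOf_eq, mem_preimage, regionBetween, Prod.fst_swap, Prod.snd_swap, mem_Ioo]
  constructor
  · rintro ⟨⟨h0, h1⟩, hfar, hhalf⟩
    have ht1 : v.2 < 1 := by nlinarith [sq_nonneg v.1]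
    have hm : 0 < 1 - v.2 ^ 2 := by nlinarith
    have hk : 0 < 1 - (b - v.2) ^ 2 := by nlinarith
    have hm0 : 0 < √(1 - v.2 ^ 2) := sqrt_pos.mpr hm
    have hk0 : 0 < √(1 - (b - v.2) ^ 2) := sqrt_pos.mpr hk
    have hvm : |v.1| < √(1 - v.2 ^ 2) := by
      rw [← sqrt_sq_eq_abs]; exact sqrt_lt_sqrt (sq_nonneg _) (by linarith)
    have hkm : √(1 - v.2 ^ 2) < √(1 - (b - v.2) ^ 2) := sqrt_lt_sqrt hm.le (by nlinarith)
    have hka : √(1 - (b - v.2) ^ 2) < |a - v.1| := by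
      rw [← sqrt_sq_eq_abs]; exact sqrt_lt_sqrt hk.le (by linarith)
    have hvm' := abs_lt.mp hvm
    refine ⟨⟨hhalf, ht1⟩, by linarith [hvm'.1], ?_⟩
    rcases le_or_gt v.1 a with hva | hva
    · rw [abs_of_nonneg (by linarith)] at hka
      linarith
    · rw [abs_of_neg (by linarith)] at hka
      linarith [hvm'.2]
  · rintro ⟨⟨hhalf, ht1⟩, hlo, hhi⟩
    have hm : 0 < 1 - v.2 ^ 2 := by nlinarith
    have hk : 0 < 1 - (b - v.2) ^ 2 := by nlinarith
    have hmsq : √(1 - v.2 ^ 2) ^ 2 = 1 - v.2 ^ 2 := sq_sqrt hm.le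
    have hksq : √(1 - (b - v.2) ^ 2) ^ 2 = 1 - (b - v.2) ^ 2 := sq_sqrt hk.le
    have hk0 : 0 < √(1 - (b - v.2) ^ 2) := sqrt_pos.mpr hk
    have hrb := right_boundary_close ha hV0 hV1 hhalf.le ht1
    have hvm : v.1 < √(1 - v.2 ^ 2) := by linarith
    have hsq : v.1 ^ 2 < √(1 - v.2 ^ 2) ^ 2 := sq_lt_sq' hlo hvm
    have hav : √(1 - (b - v.2) ^ 2) < a - v.1 := by linarith
    have hav2 : √(1 - (b - v.2) ^ 2) ^ 2 < (a - v.1) ^ 2 :=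
      pow_lt_pow_left₀ hav hk0.le two_ne_zero
    refine ⟨⟨by linarith, by nlinarith⟩, by linarith, hhalf⟩

/-- Volume of the upper half of the far set: the half-lens integral `L(a, b)`. [folklore] -/
theorem volume_farSlice_upper {a b : ℝ} (ha : 0 ≤ a) (hV0 : a ^ 2 + b ^ 2 < 1)
    (hV1 : a ^ 2 + (b - 1) ^ 2 < 1) :
    volume {v : ℝ × ℝ | (v.1 ^ 2 + v.2 ^ 2 < 1 ∧ v.1 ^ 2 + (v.2 - 1) ^ 2 < 1) ∧
      1 < (a - v.1) ^ 2 + (b - v.2) ^ 2 ∧ 1 / 2 < v.2} =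
    ∫⁻ t in Ioo (1 / 2 : ℝ) 1, ENNReal.ofReal (a + √(1 - t ^ 2) - √(1 - (b - t) ^ 2)) := by
  have hR : MeasurableSet (regionBetween (fun t => -√(1 - t ^ 2))
      (fun t => a - √(1 - (b - t) ^ 2)) (Ioo (1 / 2 : ℝ) 1)) :=
    measurableSet_regionBetween (by fun_prop) (by fun_prop) measurableSet_Ioo
  rw [farSlice_upper_eq ha hV0 hV1, Measure.volume_eq_prod,
    (Measure.measurePreserving_swap (μ := (volume : Measure ℝ))
      (ν := (volume : Measure ℝ))).measure_preimage hR.nullMeasurableSet,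
    volume_regionBetween_eq_lintegral' (by fun_prop) (by fun_prop) measurableSet_Ioo]
  refine setLIntegral_congr_fun measurableSet_Ioo (fun t _ => ?_)
  simp only [Pi.sub_apply]
  congr 1
  ring

/-- The mirror `(v₁, v₂) ↦ (v₁, 1 − v₂)` (reflection in the axis of the lens) preserves Lebesgue
measure. [folklore] -/
theorem measurePreserving_mirror :
    MeasurePreserving (fun v : ℝ × ℝ => (v.1, 1 - v.2)) volume volume :=
  (MeasurePreserving.id (volume : Measure ℝ)).prod (Measure.measurePreserving_sub_left volume (1 : ℝ))

/-- The reflection `(v₁, v₂) ↦ (−v₁, v₂)` preserves Lebesgue measure. [folklore] -/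
theorem measurePreserving_reflect :
    MeasurePreserving (fun v : ℝ × ℝ => (-v.1, v.2)) volume volume :=
  (Measure.measurePreserving_neg (volume : Measure ℝ)).prod (MeasurePreserving.id volume)

/-- The lower half (`v₂ < 1/2`) of the far set of `u = (a, b)` is the mirror image of the upper
half of the far set of the mirrored point `(a, 1 − b)`. [folklore] -/
theorem farSlice_lower_eq (a b : ℝ) :
    {v : ℝ × ℝ | (v.1 ^ 2 + v.2 ^ 2 < 1 ∧ v.1 ^ 2 + (v.2 - 1) ^ 2 < 1) ∧
      1 < (a - v.1) ^ 2 + (b - v.2) ^ 2 ∧ v.2 < 1 / 2} =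
    (fun v : ℝ × ℝ => (v.1, 1 - v.2)) ⁻¹'
      {v : ℝ × ℝ | (v.1 ^ 2 + v.2 ^ 2 < 1 ∧ v.1 ^ 2 + (v.2 - 1) ^ 2 < 1) ∧
        1 < (a - v.1) ^ 2 + ((1 - b) - v.2) ^ 2 ∧ 1 / 2 < v.2} := by
  ext v
  simp only [mem_setOf_eq, mem_preimage]
  constructor
  · rintro ⟨⟨h0, h1⟩, hf, hh⟩
    exact ⟨⟨by linarith, by linarith⟩, by linarith, by linarith⟩
  · rintro ⟨⟨h0, h1⟩, hf, hh⟩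
    exact ⟨⟨by linarith, by linarith⟩, by linarith, by linarith⟩

/-- The horizontal line `v₂ = 1/2` is Lebesgue-null in the plane. [folklore] -/
theorem volume_line_half : volume {v : ℝ × ℝ | v.2 = 1 / 2} = 0 := by
  have : {v : ℝ × ℝ | v.2 = 1 / 2} = (univ : Set ℝ) ×ˢ {(1 / 2 : ℝ)} := by
    ext v; simp
  rw [this, Measure.volume_eq_prod, Measure.prod_prod, Real.volume_singleton, mul_zero]

/-- **Area of the far set (Lemma E).** For `u = (a, b)` in the lens with `a > 0`:
if `u` is at distance `> 1` from the tip `(−√3/2, 1/2)` then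
`vol{v ∈ V : |u − v| > 1} = 5π/6 − √3/4 − a/2 − A(|u|)/2 − A(|u − (0,1)|)/2` (and this is `≥ 0`),
`A(r) = 2 arccos(r/2) − r√(1 − r²/4)` the lens area. [folklore] -/
theorem volume_farSlice_far {a b : ℝ} (ha : 0 < a) (hV0 : a ^ 2 + b ^ 2 < 1)
    (hV1 : a ^ 2 + (b - 1) ^ 2 < 1) (hfar : 1 < (a + √3 / 2) ^ 2 + (b - 1 / 2) ^ 2) :
    volume {v : ℝ × ℝ | (v.1 ^ 2 + v.2 ^ 2 < 1 ∧ v.1 ^ 2 + (v.2 - 1) ^ 2 < 1) ∧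
      1 < (a - v.1) ^ 2 + (b - v.2) ^ 2} =
    ENNReal.ofReal (5 * π / 6 - √3 / 4 - a / 2
      - (2 * arccos (√(a ^ 2 + b ^ 2) / 2) -
          √(a ^ 2 + b ^ 2) * √(1 - √(a ^ 2 + b ^ 2) ^ 2 / 4)) / 2
      - (2 * arccos (√(a ^ 2 + (b - 1) ^ 2) / 2) -
          √(a ^ 2 + (b - 1) ^ 2) * √(1 - √(a ^ 2 + (b - 1) ^ 2) ^ 2 / 4)) / 2) ∧
    0 ≤ 5 * π / 6 - √3 / 4 - a / 2
      - (2 * arccos (√(a ^ 2 + b ^ 2) / 2) -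
          √(a ^ 2 + b ^ 2) * √(1 - √(a ^ 2 + b ^ 2) ^ 2 / 4)) / 2
      - (2 * arccos (√(a ^ 2 + (b - 1) ^ 2) / 2) -
          √(a ^ 2 + (b - 1) ^ 2) * √(1 - √(a ^ 2 + (b - 1) ^ 2) ^ 2 / 4)) / 2 := by
  -- the two halves
  have hV0' : a ^ 2 + (1 - b) ^ 2 < 1 := by linarith
  have hV1' : a ^ 2 + ((1 - b) - 1) ^ 2 < 1 := by linarith
  have hfar' : 1 < (a + √3 / 2) ^ 2 + ((1 - b) - 1 / 2) ^ 2 := by linarith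
  obtain ⟨hup, hup0⟩ := halfLens_far ha hV0 hV1 hfar
  obtain ⟨hlo, hlo0⟩ := halfLens_far ha hV0' hV1' hfar'
  have hmeas : ∀ c : ℝ, MeasurableSet {v : ℝ × ℝ | (v.1 ^ 2 + v.2 ^ 2 < 1 ∧
      v.1 ^ 2 + (v.2 - 1) ^ 2 < 1) ∧ 1 < (a - v.1) ^ 2 + (c - v.2) ^ 2 ∧ 1 / 2 < v.2} := by
    intro c
    simp only [setOf_and]
    refine ((measurableSet_lt (by fun_prop) (by fun_prop)).inter
      (measurableSet_lt (by fun_prop) (by fun_prop))).inter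
      ((measurableSet_lt (by fun_prop) (by fun_prop)).inter
      (measurableSet_lt (by fun_prop) (by fun_prop)))
  have hmeas_lo : MeasurableSet {v : ℝ × ℝ | (v.1 ^ 2 + v.2 ^ 2 < 1 ∧
      v.1 ^ 2 + (v.2 - 1) ^ 2 < 1) ∧ 1 < (a - v.1) ^ 2 + (b - v.2) ^ 2 ∧ v.2 < 1 / 2} := by
    simp only [setOf_and]
    refine ((measurableSet_lt (by fun_prop) (by fun_prop)).inter
      (measurableSet_lt (by fun_prop) (by fun_prop))).inter
      ((measurableSet_lt (by fun_prop) (by fun_prop)).inter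
      (measurableSet_lt (by fun_prop) (by fun_prop)))
  -- volumes of the halves
  have hvol_up := volume_farSlice_upper ha.le hV0 hV1
  have hvol_lo : volume {v : ℝ × ℝ | (v.1 ^ 2 + v.2 ^ 2 < 1 ∧ v.1 ^ 2 + (v.2 - 1) ^ 2 < 1) ∧
      1 < (a - v.1) ^ 2 + (b - v.2) ^ 2 ∧ v.2 < 1 / 2} =
      ∫⁻ t in Ioo (1 / 2 : ℝ) 1, ENNReal.ofReal (a + √(1 - t ^ 2) - √(1 - ((1 - b) - t) ^ 2)) := by
    rw [farSlice_lower_eq, measurePreserving_mirror.measure_preimage (hmeas _).nullMeasurableSet,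
      volume_farSlice_upper ha.le hV0' hV1']
  -- split `E(u)` along the null line `v₂ = 1/2`
  have hsub : {v : ℝ × ℝ | (v.1 ^ 2 + v.2 ^ 2 < 1 ∧ v.1 ^ 2 + (v.2 - 1) ^ 2 < 1) ∧
      1 < (a - v.1) ^ 2 + (b - v.2) ^ 2 ∧ v.2 < 1 / 2} ∪
      {v : ℝ × ℝ | (v.1 ^ 2 + v.2 ^ 2 < 1 ∧ v.1 ^ 2 + (v.2 - 1) ^ 2 < 1) ∧
      1 < (a - v.1) ^ 2 + (b - v.2) ^ 2 ∧ 1 / 2 < v.2} ⊆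
      {v : ℝ × ℝ | (v.1 ^ 2 + v.2 ^ 2 < 1 ∧ v.1 ^ 2 + (v.2 - 1) ^ 2 < 1) ∧
      1 < (a - v.1) ^ 2 + (b - v.2) ^ 2} := by
    rintro v (⟨hv, hf, -⟩ | ⟨hv, hf, -⟩) <;> exact ⟨hv, hf⟩
  have hnull : volume ({v : ℝ × ℝ | (v.1 ^ 2 + v.2 ^ 2 < 1 ∧ v.1 ^ 2 + (v.2 - 1) ^ 2 < 1) ∧
      1 < (a - v.1) ^ 2 + (b - v.2) ^ 2} \
      ({v : ℝ × ℝ | (v.1 ^ 2 + v.2 ^ 2 < 1 ∧ v.1 ^ 2 + (v.2 - 1) ^ 2 < 1) ∧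
      1 < (a - v.1) ^ 2 + (b - v.2) ^ 2 ∧ v.2 < 1 / 2} ∪
      {v : ℝ × ℝ | (v.1 ^ 2 + v.2 ^ 2 < 1 ∧ v.1 ^ 2 + (v.2 - 1) ^ 2 < 1) ∧
      1 < (a - v.1) ^ 2 + (b - v.2) ^ 2 ∧ 1 / 2 < v.2})) = 0 := by
    refine measure_mono_null ?_ volume_line_half
    rintro v ⟨⟨hv, hf⟩, hnot⟩
    simp only [mem_union, mem_setOf_eq, not_or, not_and, not_lt] at hnot
    have h1 := hnot.1 hv hf
    have h2 := hnot.2 hv hf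
    simp only [mem_setOf_eq]
    linarith
  have hdisj : Disjoint {v : ℝ × ℝ | (v.1 ^ 2 + v.2 ^ 2 < 1 ∧ v.1 ^ 2 + (v.2 - 1) ^ 2 < 1) ∧
      1 < (a - v.1) ^ 2 + (b - v.2) ^ 2 ∧ v.2 < 1 / 2}
      {v : ℝ × ℝ | (v.1 ^ 2 + v.2 ^ 2 < 1 ∧ v.1 ^ 2 + (v.2 - 1) ^ 2 < 1) ∧
      1 < (a - v.1) ^ 2 + (b - v.2) ^ 2 ∧ 1 / 2 < v.2} :=
    Set.disjoint_left.mpr (fun v h1 h2 => by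
      simp only [mem_setOf_eq] at h1 h2; linarith [h1.2.2, h2.2.2])
  -- the value
  have hodd : arcsin (1 / 2 - (1 - b)) + (1 / 2 - (1 - b)) * √(1 - (1 / 2 - (1 - b)) ^ 2) =
      -(arcsin (1 / 2 - b) + (1 / 2 - b) * √(1 - (1 / 2 - b) ^ 2)) := by
    rw [show 1 / 2 - (1 - b) = -(1 / 2 - b) by ring, arcsin_neg, neg_sq]
    ring
  have hsq1 : a ^ 2 + (1 - b) ^ 2 = a ^ 2 + (b - 1) ^ 2 := by ring
  rw [hsq1, hodd] at hlo hlo0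
  refine ⟨?_, ?_⟩
  · rw [← measure_eq_measure_of_null_sdiff hsub hnull, measure_union hdisj (hmeas b), hvol_lo,
      hvol_up, hlo, hup, ← ENNReal.ofReal_add hlo0 hup0]
    congr 1
    ring
  · linarith [hlo0, hup0]

/-- **Area of the far set, near case.** For `u = (a, b)` in the lens with `a ≥ 0` within distance
`1` of the tip `(−√3/2, 1/2)`, the far set `{v ∈ V : |u − v| > 1}` is Lebesgue-null. [folklore] -/
theorem volume_farSlice_near {a b : ℝ} (ha : 0 ≤ a) (hV0 : a ^ 2 + b ^ 2 < 1)
    (hV1 : a ^ 2 + (b - 1) ^ 2 < 1) (hnear : (a + √3 / 2) ^ 2 + (b - 1 / 2) ^ 2 ≤ 1) :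
    volume {v : ℝ × ℝ | (v.1 ^ 2 + v.2 ^ 2 < 1 ∧ v.1 ^ 2 + (v.2 - 1) ^ 2 < 1) ∧
      1 < (a - v.1) ^ 2 + (b - v.2) ^ 2} = 0 := by
  have hV0' : a ^ 2 + (1 - b) ^ 2 < 1 := by linarith
  have hV1' : a ^ 2 + ((1 - b) - 1) ^ 2 < 1 := by linarith
  have hnear' : (a + √3 / 2) ^ 2 + ((1 - b) - 1 / 2) ^ 2 ≤ 1 := by linarith
  have hup : volume {v : ℝ × ℝ | (v.1 ^ 2 + v.2 ^ 2 < 1 ∧ v.1 ^ 2 + (v.2 - 1) ^ 2 < 1) ∧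
      1 < (a - v.1) ^ 2 + (b - v.2) ^ 2 ∧ 1 / 2 < v.2} = 0 := by
    rw [volume_farSlice_upper ha hV0 hV1, halfLens_near ha hV0 hV1 hnear]
  have hmeas : MeasurableSet {v : ℝ × ℝ | (v.1 ^ 2 + v.2 ^ 2 < 1 ∧
      v.1 ^ 2 + (v.2 - 1) ^ 2 < 1) ∧ 1 < (a - v.1) ^ 2 + ((1 - b) - v.2) ^ 2 ∧ 1 / 2 < v.2} := by
    simp only [setOf_and]
    refine ((measurableSet_lt (by fun_prop) (by fun_prop)).inter
      (measurableSet_lt (by fun_prop) (by fun_prop))).inter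
      ((measurableSet_lt (by fun_prop) (by fun_prop)).inter
      (measurableSet_lt (by fun_prop) (by fun_prop)))
  have hlo : volume {v : ℝ × ℝ | (v.1 ^ 2 + v.2 ^ 2 < 1 ∧ v.1 ^ 2 + (v.2 - 1) ^ 2 < 1) ∧
      1 < (a - v.1) ^ 2 + (b - v.2) ^ 2 ∧ v.2 < 1 / 2} = 0 := by
    rw [farSlice_lower_eq, measurePreserving_mirror.measure_preimage hmeas.nullMeasurableSet,
      volume_farSlice_upper ha hV0' hV1', halfLens_near ha hV0' hV1' hnear']
  refine measure_mono_null ?_ (measure_union_null (measure_union_null hlo hup) volume_line_half)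
  intro v ⟨hv, hf⟩
  rcases lt_trichotomy v.2 (1 / 2) with h | h | h
  · exact Or.inl (Or.inl ⟨hv, hf, h⟩)
  · exact Or.inr h
  · exact Or.inl (Or.inr ⟨hv, hf, h⟩)



/-!
## Part III-b (appended): the domain `D⁺` in polar coordinates

With `T₋ = (−√3/2, 1/2)` the left tip of `V`, the set `D⁺ = {u ∈ V : u₁ > 0, |u − T₋| > 1}` of
points of the right half-lens whose far set is non-null is, in polar coordinates about the
origin, `{ρ ∈ (0,1), β ∈ (π/2 − θ, 5π/6 − θ)}`, `θ = arccos(ρ/2)` (`mem_Dplus_polar_iff`): an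
angular interval of CONSTANT length `π/3`. Hence (Tonelli in polar coordinates,
`lintegral_Dplus_polar`)

* `lintegral_Dplus_halfLensArea` : `∫_{D⁺} A(|u|)/2 du = (π/6)(π/2 − 3√3/8)`
  (`∫₀¹ ρA(ρ) dρ` is `HardDiscTriangleVolume.integral_mul_lensArea`),
* `lintegral_Dplus_linear` : `∫_{D⁺} (5π/6 − √3/4 − u₁/2) du = 5π²/36 − √3π/12 + 1/8`
  (inner integral `c₀ρπ/3 − (ρ²/2)(sin(5π/6 − θ) − cos θ)`, outer one by the fundamental
  theorem of calculus with `∫₀¹ ρ²√(1−ρ²/4) dρ = π/6 − √3/8`).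
-/

/-! ### The domain `D⁺ = {u ∈ V : u₁ > 0, |u − (−√3/2, 1/2)| > 1}` in polar coordinates -/

/-- Polar description of `D⁺`: for `ρ > 0` and `β ∈ (−π, π)`, the point `(ρ cos β, ρ sin β)` lies in
`D⁺` iff `ρ < 1` and `π/2 − θ < β < 5π/6 − θ`, `θ = arccos(ρ/2)` — an angular interval of length
exactly `π/3`. [folklore] -/
theorem mem_Dplus_polar_iff {ρ β : ℝ} (hρ : 0 < ρ) (hβ1 : -π < β) (hβ2 : β < π) :
    (((ρ * cos β) ^ 2 + (ρ * sin β) ^ 2 < 1 ∧ (ρ * cos β) ^ 2 + (ρ * sin β - 1) ^ 2 < 1) ∧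
      0 < ρ * cos β ∧ 1 < (ρ * cos β + √3 / 2) ^ 2 + (ρ * sin β - 1 / 2) ^ 2) ↔
    (ρ < 1 ∧ π / 2 - arccos (ρ / 2) < β ∧ β < 5 * π / 6 - arccos (ρ / 2)) := by
  have hpy := sin_sq_add_cos_sq β
  have h3 : √3 ^ 2 = 3 := sq_sqrt (by norm_num)
  have e1 : (ρ * cos β) ^ 2 + (ρ * sin β) ^ 2 = ρ ^ 2 := by
    linear_combination ρ ^ 2 * hpy
  have e2 : (ρ * cos β) ^ 2 + (ρ * sin β - 1) ^ 2 = ρ ^ 2 - 2 * ρ * sin β + 1 := by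
    linear_combination ρ ^ 2 * hpy
  have e3 : (ρ * cos β + √3 / 2) ^ 2 + (ρ * sin β - 1 / 2) ^ 2 =
      ρ ^ 2 + ρ * (√3 * cos β - sin β) + 1 := by
    linear_combination ρ ^ 2 * hpy + (1 / 4) * h3
  have e4 : √3 * cos β - sin β = 2 * cos (β + π / 6) := by
    rw [cos_add, cos_pi_div_six, sin_pi_div_six]; ring
  rw [e1, e2, e3, e4]
  constructor
  · rintro ⟨⟨h1, h2⟩, h3', h4⟩
    have hρ1 : ρ < 1 := by nlinarith only [h1, hρ]
    set θ := arccos (ρ / 2) with hθ_def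
    have hcosθ : cos θ = ρ / 2 := cos_arccos (by linarith) (by linarith)
    have hθ1 : π / 3 < θ := by
      rw [hθ_def, show π / 3 = arccos (1 / 2) by
        rw [show (1:ℝ) / 2 = cos (π / 3) by rw [cos_pi_div_three], arccos_cos (by positivity)
          (by linarith [pi_pos])]]
      exact strictAntiOn_arccos ⟨by linarith, by linarith⟩ ⟨by linarith, by linarith⟩ (by linarith)
    have hθ2 : θ < π / 2 := arccos_lt_pi_div_two.mpr (by linarith)
    -- `sin β > ρ/2 > 0`, hence `0 < β < π`; `cos β > 0`, hence `β < π/2`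
    have hsin : ρ / 2 < sin β := by nlinarith only [h2, hρ]
    have hcos : 0 < cos β := pos_of_mul_pos_right h3' hρ.le
    have hβ0 : 0 < β := by
      by_contra h
      have := sin_nonpos_of_nonpos_of_neg_pi_le (not_lt.mp h) hβ1.le
      linarith
    have hβpi2 : β < π / 2 := by
      by_contra h
      have := cos_nonpos_of_pi_div_two_le_of_le (not_lt.mp h) (by linarith)
      linarith
    refine ⟨hρ1, ?_, ?_⟩
    · have h1' : sin (π / 2 - θ) < sin β := by rw [sin_pi_div_two_sub, hcosθ]; exact hsin
      exact (strictMonoOn_sin.lt_iff_lt ⟨by linarith, by linarith⟩ ⟨by linarith, by linarith⟩).mp h1'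
    · have hfar : cos (π - θ) < cos (β + π / 6) := by
        rw [cos_pi_sub, hcosθ]
        nlinarith
      have := (strictAntiOn_cos.lt_iff_gt (a := π - θ) (b := β + π / 6)
        ⟨by linarith, by linarith⟩ ⟨by linarith, by linarith⟩).mp hfar
      linarith
  · rintro ⟨hρ1, hlo, hhi⟩
    set θ := arccos (ρ / 2) with hθ_def
    have hcosθ : cos θ = ρ / 2 := cos_arccos (by linarith) (by linarith)
    have hθ1 : π / 3 < θ := by
      rw [hθ_def, show π / 3 = arccos (1 / 2) by
        rw [show (1:ℝ) / 2 = cos (π / 3) by rw [cos_pi_div_three], arccos_cos (by positivity)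
          (by linarith [pi_pos])]]
      exact strictAntiOn_arccos ⟨by linarith, by linarith⟩ ⟨by linarith, by linarith⟩ (by linarith)
    have hθ2 : θ < π / 2 := arccos_lt_pi_div_two.mpr (by linarith)
    have hβ0 : 0 < β := by linarith
    have hβpi2 : β < π / 2 := by linarith
    have hcos : 0 < cos β := cos_pos_of_mem_Ioo ⟨by linarith, hβpi2⟩
    have hsin : ρ / 2 < sin β := by
      have := strictMonoOn_sin ⟨by linarith, by linarith⟩ ⟨by linarith, by linarith⟩ hlo
      rwa [sin_pi_div_two_sub, hcosθ] at this
    have hfar : cos (π - θ) < cos (β + π / 6) :=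
      strictAntiOn_cos ⟨by linarith, by linarith⟩ ⟨by linarith, by linarith⟩ (by linarith)
    rw [cos_pi_sub, hcosθ] at hfar
    exact ⟨⟨by nlinarith only [hρ, hρ1], by nlinarith only [hsin, hρ]⟩, mul_pos hρ hcos,
      by nlinarith only [hfar, hρ]⟩

/-- `D⁺` is measurable. [folklore] -/
theorem measurableSet_Dplus : MeasurableSet {u : ℝ × ℝ | (u.1 ^ 2 + u.2 ^ 2 < 1 ∧
      u.1 ^ 2 + (u.2 - 1) ^ 2 < 1) ∧ 0 < u.1 ∧ 1 < (u.1 + √3 / 2) ^ 2 + (u.2 - 1 / 2) ^ 2} := by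
  simp only [setOf_and]
  exact ((measurableSet_lt (by fun_prop) (by fun_prop)).inter
    (measurableSet_lt (by fun_prop) (by fun_prop))).inter
    ((measurableSet_lt (by fun_prop) (by fun_prop)).inter
    (measurableSet_lt (by fun_prop) (by fun_prop)))

/-- **Integration over `D⁺` in polar coordinates**: for measurable `g ≥ 0`,
`∫_{D⁺} g = ∫_{ρ ∈ (0,1)} ∫_{β ∈ (π/2 − θ(ρ), 5π/6 − θ(ρ))} ρ · g(ρ cos β, ρ sin β) dβ dρ`,
`θ(ρ) = arccos(ρ/2)` (Tonelli). [folklore] -/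
theorem lintegral_Dplus_polar (g : ℝ × ℝ → ENNReal) (hg : Measurable g) :
    ∫⁻ u in {u : ℝ × ℝ | (u.1 ^ 2 + u.2 ^ 2 < 1 ∧ u.1 ^ 2 + (u.2 - 1) ^ 2 < 1) ∧
      0 < u.1 ∧ 1 < (u.1 + √3 / 2) ^ 2 + (u.2 - 1 / 2) ^ 2}, g u =
    ∫⁻ ρ in Ioo (0:ℝ) 1, ∫⁻ β in Ioo (π / 2 - arccos (ρ / 2)) (5 * π / 6 - arccos (ρ / 2)),
      ENNReal.ofReal ρ * g (ρ * cos β, ρ * sin β) := by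
  -- the integrand in polar coordinates
  have hGm : Measurable fun p : ℝ × ℝ => if p.1 < 1 ∧ π / 2 - arccos (p.1 / 2) < p.2 ∧
      p.2 < 5 * π / 6 - arccos (p.1 / 2) then ENNReal.ofReal p.1 * g (p.1 * cos p.2, p.1 * sin p.2)
      else 0 := by
    refine Measurable.ite ?_ ((ENNReal.measurable_ofReal.comp measurable_fst).mul
      (hg.comp (by fun_prop))) measurable_const
    simp only [setOf_and]
    exact (measurableSet_lt (by fun_prop) (by fun_prop)).inter
      ((measurableSet_lt (by fun_prop) (by fun_prop)).inter
      (measurableSet_lt (by fun_prop) (by fun_prop)))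
  rw [← lintegral_indicator measurableSet_Dplus, ← lintegral_comp_polarCoord_symm]
  have heq : EqOn (fun p : ℝ × ℝ => ENNReal.ofReal p.1 • ({u : ℝ × ℝ | (u.1 ^ 2 + u.2 ^ 2 < 1 ∧
      u.1 ^ 2 + (u.2 - 1) ^ 2 < 1) ∧ 0 < u.1 ∧ 1 < (u.1 + √3 / 2) ^ 2 + (u.2 - 1 / 2) ^ 2}.indicator
      g (polarCoord.symm p)))
      (fun p : ℝ × ℝ => if p.1 < 1 ∧ π / 2 - arccos (p.1 / 2) < p.2 ∧
        p.2 < 5 * π / 6 - arccos (p.1 / 2) then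
        ENNReal.ofReal p.1 * g (p.1 * cos p.2, p.1 * sin p.2) else 0) polarCoord.target := by
    intro p hp
    have hp1 : 0 < p.1 := hp.1
    have hchar := mem_Dplus_polar_iff (ρ := p.1) (β := p.2) hp1 hp.2.1 hp.2.2
    simp only [smul_eq_mul, polarCoord_symm_apply, indicator_apply, mem_setOf_eq]
    by_cases hc : p.1 < 1 ∧ π / 2 - arccos (p.1 / 2) < p.2 ∧ p.2 < 5 * π / 6 - arccos (p.1 / 2)
    · rw [if_pos hc, if_pos (hchar.mpr hc)]
    · rw [if_neg hc, if_neg (fun h => hc (hchar.mp h)), mul_zero]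
  rw [setLIntegral_congr_fun polarCoord.open_target.measurableSet heq, polarCoord_target,
    Measure.volume_eq_prod, ← Measure.prod_restrict, lintegral_prod _ hGm.aemeasurable]
  -- the outer integral lives on `(0, 1)`, the inner one on the angular interval
  have hinner : EqOn (fun ρ : ℝ => ∫⁻ β in Ioo (-π) π, (if ρ < 1 ∧ π / 2 - arccos (ρ / 2) < β ∧
      β < 5 * π / 6 - arccos (ρ / 2) then ENNReal.ofReal ρ * g (ρ * cos β, ρ * sin β) else 0))
      ((Iio (1:ℝ)).indicator fun ρ => ∫⁻ β in Ioo (π / 2 - arccos (ρ / 2))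
        (5 * π / 6 - arccos (ρ / 2)), ENNReal.ofReal ρ * g (ρ * cos β, ρ * sin β)) (Ioi 0) := by
    intro ρ hρ
    dsimp only
    by_cases h1 : ρ < 1
    · rw [indicator_of_mem (show ρ ∈ Iio (1:ℝ) from h1)]
      have hsub : Ioo (π / 2 - arccos (ρ / 2)) (5 * π / 6 - arccos (ρ / 2)) ⊆ Ioo (-π) π := by
        intro β hβ
        have := arccos_nonneg (ρ / 2)
        have := arccos_le_pi (ρ / 2)
        exact ⟨by linarith [hβ.1, pi_pos], by linarith [hβ.2, pi_pos]⟩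
      have hI : (fun β : ℝ => (if ρ < 1 ∧ π / 2 - arccos (ρ / 2) < β ∧
          β < 5 * π / 6 - arccos (ρ / 2) then ENNReal.ofReal ρ * g (ρ * cos β, ρ * sin β) else 0))
          = (Ioo (π / 2 - arccos (ρ / 2)) (5 * π / 6 - arccos (ρ / 2))).indicator
            (fun β => ENNReal.ofReal ρ * g (ρ * cos β, ρ * sin β)) := by
        funext β
        simp only [indicator, mem_Ioo, h1, true_and]
      rw [hI, lintegral_indicator measurableSet_Ioo, Measure.restrict_restrict measurableSet_Ioo,
        inter_eq_left.mpr hsub]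
    · rw [indicator_of_notMem (show ρ ∉ Iio (1:ℝ) from h1)]
      simp only [h1, false_and, if_false, lintegral_zero]
  rw [setLIntegral_congr_fun measurableSet_Ioi hinner, lintegral_indicator measurableSet_Iio,
    Measure.restrict_restrict measurableSet_Iio, Iio_inter_Ioi]

/-! ### The two explicit integrals over `D⁺` -/

/-- `∫_{D⁺} A(|u|)/2 du = (π/6) · ∫₀¹ ρ A(ρ) dρ = (π/6)(π/2 − 3√3/8)` (`A` the lens area;
the angular interval has constant length `π/3`). [folklore] -/
theorem lintegral_Dplus_halfLensArea :
    ∫⁻ u in {u : ℝ × ℝ | (u.1 ^ 2 + u.2 ^ 2 < 1 ∧ u.1 ^ 2 + (u.2 - 1) ^ 2 < 1) ∧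
      0 < u.1 ∧ 1 < (u.1 + √3 / 2) ^ 2 + (u.2 - 1 / 2) ^ 2},
      ENNReal.ofReal ((2 * arccos (√(u.1 ^ 2 + u.2 ^ 2) / 2) -
        √(u.1 ^ 2 + u.2 ^ 2) * √(1 - √(u.1 ^ 2 + u.2 ^ 2) ^ 2 / 4)) / 2) =
    ENNReal.ofReal (π / 6 * (π / 2 - 3 * √3 / 8)) := by
  rw [lintegral_Dplus_polar (fun u : ℝ × ℝ => ENNReal.ofReal ((2 * arccos (√(u.1 ^ 2 + u.2 ^ 2) / 2) -
        √(u.1 ^ 2 + u.2 ^ 2) * √(1 - √(u.1 ^ 2 + u.2 ^ 2) ^ 2 / 4)) / 2))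
    (ENNReal.measurable_ofReal.comp (by fun_prop))]
  have hinner : EqOn (fun ρ : ℝ => ∫⁻ β in Ioo (π / 2 - arccos (ρ / 2)) (5 * π / 6 - arccos (ρ / 2)),
      ENNReal.ofReal ρ * ENNReal.ofReal ((2 * arccos (√((ρ * cos β) ^ 2 + (ρ * sin β) ^ 2) / 2) -
        √((ρ * cos β) ^ 2 + (ρ * sin β) ^ 2) *
        √(1 - √((ρ * cos β) ^ 2 + (ρ * sin β) ^ 2) ^ 2 / 4)) / 2))
      (fun ρ => ENNReal.ofReal (π / 6 * (ρ * (2 * arccos (ρ / 2) - ρ * √(1 - ρ ^ 2 / 4)))))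
      (Ioo 0 1) := by
    intro ρ hρ
    dsimp only
    have hsq : ∀ β : ℝ, √((ρ * cos β) ^ 2 + (ρ * sin β) ^ 2) = ρ := by
      intro β
      rw [show (ρ * cos β) ^ 2 + (ρ * sin β) ^ 2 = ρ ^ 2 by
        linear_combination ρ ^ 2 * (sin_sq_add_cos_sq β), sqrt_sq hρ.1.le]
    simp only [hsq]
    have hA := (HardDiscTriangleVolume.volume_lens hρ.1.le hρ.2.le).2
    rw [← ENNReal.ofReal_mul hρ.1.le, lintegral_const, Measure.restrict_apply_univ,
      Real.volume_Ioo, ← ENNReal.ofReal_mul (mul_nonneg hρ.1.le (by linarith [hA]))]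
    congr 1
    rw [show 5 * π / 6 - arccos (ρ / 2) - (π / 2 - arccos (ρ / 2)) = π / 3 by ring]
    ring
  rw [setLIntegral_congr_fun measurableSet_Ioo hinner]
  have hint : IntegrableOn (fun ρ : ℝ => π / 6 * (ρ * (2 * arccos (ρ / 2) - ρ * √(1 - ρ ^ 2 / 4))))
      (Ioo 0 1) volume :=
    (Continuous.integrableOn_Icc (by fun_prop)).mono_set Ioo_subset_Icc_self
  have hnn : 0 ≤ᵐ[volume.restrict (Ioo (0:ℝ) 1)]
      fun ρ : ℝ => π / 6 * (ρ * (2 * arccos (ρ / 2) - ρ * √(1 - ρ ^ 2 / 4))) := by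
    filter_upwards [ae_restrict_mem measurableSet_Ioo] with ρ hρ
    exact mul_nonneg (by positivity) (mul_nonneg hρ.1.le
      (HardDiscTriangleVolume.volume_lens hρ.1.le hρ.2.le).2)
  rw [← ofReal_integral_eq_lintegral_ofReal hint hnn, ← integral_Ioc_eq_integral_Ioo,
    ← intervalIntegral.integral_of_le zero_le_one, intervalIntegral.integral_const_mul,
    HardDiscTriangleVolume.integral_mul_lensArea]

/-- `d/dρ [arcsin(ρ/2) − ρ(2−ρ²)√(1−ρ²/4)/4] = ρ²√(1−ρ²/4)` on `(−2, 2)`. [folklore] -/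
theorem hasDerivAt_sqSqrtPrim {r : ℝ} (h1 : -2 < r) (h2 : r < 2) :
    HasDerivAt (fun r : ℝ => arcsin (r / 2) - r * (2 - r ^ 2) * √(1 - r ^ 2 / 4) / 4)
      (r ^ 2 * √(1 - r ^ 2 / 4)) r := by
  have hw : 0 < 1 - r ^ 2 / 4 := by nlinarith
  set w := √(1 - r ^ 2 / 4) with hw_def
  have hw0' : w ≠ 0 := (sqrt_pos.mpr hw).ne'
  have hwsq : w ^ 2 = 1 - r ^ 2 / 4 := sq_sqrt hw.le
  have hr1 : r / 2 ≠ -1 := by intro h; linarith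
  have hr2 : r / 2 ≠ 1 := by intro h; linarith
  have hd : HasDerivAt (fun x : ℝ => x / 2) (1 / 2) r := (hasDerivAt_id' r).div_const 2
  have hasin : HasDerivAt (fun x => arcsin (x / 2)) (1 / √(1 - (r / 2) ^ 2) * (1 / 2)) r := by
    have h := (hasDerivAt_arcsin hr1 hr2).comp r hd
    exact h
  have hsq' : √(1 - (r / 2) ^ 2) = w := by rw [hw_def]; congr 1; ring
  rw [hsq'] at hasin
  have hin : HasDerivAt (fun x : ℝ => 1 - x ^ 2 / 4) (-(2 * r / 4)) r := by
    simpa using ((hasDerivAt_pow 2 r).div_const 4).const_sub 1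
  have hsqrt : HasDerivAt (fun x => √(1 - x ^ 2 / 4)) ((-(2 * r / 4)) / (2 * w)) r := by
    have := hin.sqrt hw.ne'
    rw [← hw_def] at this
    exact this
  have hB : HasDerivAt (fun x : ℝ => x * (2 - x ^ 2)) (2 - 3 * r ^ 2) r := by
    have := (hasDerivAt_id' r).fun_mul ((hasDerivAt_pow 2 r).const_sub 2)
    refine this.congr_deriv ?_
    norm_num; ring
  have key := hasin.fun_sub ((hB.fun_mul hsqrt).div_const 4)
  rw [← hw_def] at key
  refine HasDerivAt.congr_deriv (key.congr_of_eventuallyEq ?_) ?_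
  · filter_upwards with x
    ring
  · field_simp
    linear_combination (-16 - 8 * r ^ 2) * hwsq

/-- `∫₀¹ ρ²√(1 − ρ²/4) dρ = π/6 − √3/8`. [folklore] -/
theorem integral_sq_mul_sqrt :
    ∫ r in (0:ℝ)..1, r ^ 2 * √(1 - r ^ 2 / 4) = π / 6 - √3 / 8 := by
  have hcont : ContinuousOn (fun r : ℝ => arcsin (r / 2) - r * (2 - r ^ 2) * √(1 - r ^ 2 / 4) / 4)
      (Icc 0 1) := Continuous.continuousOn (by fun_prop)
  have hint : IntervalIntegrable (fun r : ℝ => r ^ 2 * √(1 - r ^ 2 / 4)) volume 0 1 :=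
    Continuous.intervalIntegrable (by fun_prop) _ _
  rw [integral_eq_sub_of_hasDerivAt_of_le zero_le_one hcont
    (fun r hr => hasDerivAt_sqSqrtPrim (by linarith [hr.1]) (by linarith [hr.2])) hint]
  have h4 : √(4:ℝ) = 2 := by
    rw [show (4:ℝ) = 2 ^ 2 by norm_num, Real.sqrt_sq (by norm_num)]
  have h34 : √(1 - 1 ^ 2 / 4 : ℝ) = √3 / 2 := by
    rw [show (1 - 1 ^ 2 / 4 : ℝ) = 3 / 4 by norm_num, Real.sqrt_div (by norm_num), h4]
  have h1 : arcsin ((1:ℝ) / 2) = π / 6 := by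
    rw [show (1 / 2 : ℝ) = sin (π / 6) by rw [sin_pi_div_six]]
    exact arcsin_sin (by linarith [pi_pos]) (by linarith [pi_pos])
  rw [h34, h1]
  norm_num
  ring

/-- `∫₀¹ (κ ρ + ρ³/8 − (√3/4) ρ²√(1−ρ²/4)) dρ = κ/2 + 1/32 − (√3/4)(π/6 − √3/8)` (fundamental theorem
of calculus with the primitive of `hasDerivAt_sqSqrtPrim`). [folklore] -/
theorem integral_outer_linear (κ : ℝ) :
    ∫ r in (0:ℝ)..1, (κ * r + r ^ 3 / 8 - √3 / 4 * (r ^ 2 * √(1 - r ^ 2 / 4))) =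
      κ / 2 + 1 / 32 - √3 / 4 * (π / 6 - √3 / 8) := by
  have hderiv : ∀ r ∈ Ioo (0:ℝ) 1, HasDerivAt (fun r : ℝ => κ * r ^ 2 / 2 + r ^ 4 / 32 -
      √3 / 4 * (arcsin (r / 2) - r * (2 - r ^ 2) * √(1 - r ^ 2 / 4) / 4))
      (κ * r + r ^ 3 / 8 - √3 / 4 * (r ^ 2 * √(1 - r ^ 2 / 4))) r := by
    intro r hr
    have h1 := hasDerivAt_sqSqrtPrim (r := r) (by linarith [hr.1]) (by linarith [hr.2])
    have h2 : HasDerivAt (fun r : ℝ => κ * r ^ 2 / 2 + r ^ 4 / 32) (κ * r + r ^ 3 / 8) r := by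
      have := (((hasDerivAt_pow 2 r).const_mul κ).div_const 2).add ((hasDerivAt_pow 4 r).div_const 32)
      refine this.congr_deriv ?_
      push_cast
      ring
    exact h2.sub (h1.const_mul (√3 / 4))
  have hcont : ContinuousOn (fun r : ℝ => κ * r ^ 2 / 2 + r ^ 4 / 32 -
      √3 / 4 * (arcsin (r / 2) - r * (2 - r ^ 2) * √(1 - r ^ 2 / 4) / 4)) (Icc 0 1) :=
    Continuous.continuousOn (by fun_prop)
  have hint : IntervalIntegrable (fun r : ℝ => κ * r + r ^ 3 / 8 -
      √3 / 4 * (r ^ 2 * √(1 - r ^ 2 / 4))) volume 0 1 :=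
    Continuous.intervalIntegrable (by fun_prop) _ _
  rw [integral_eq_sub_of_hasDerivAt_of_le zero_le_one hcont hderiv hint]
  have h4 : √(4:ℝ) = 2 := by
    rw [show (4:ℝ) = 2 ^ 2 by norm_num, Real.sqrt_sq (by norm_num)]
  have h34 : √(1 - 1 ^ 2 / 4 : ℝ) = √3 / 2 := by
    rw [show (1 - 1 ^ 2 / 4 : ℝ) = 3 / 4 by norm_num, Real.sqrt_div (by norm_num), h4]
  have h1 : arcsin ((1:ℝ) / 2) = π / 6 := by
    rw [show (1 / 2 : ℝ) = sin (π / 6) by rw [sin_pi_div_six]]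
    exact arcsin_sin (by linarith [pi_pos]) (by linarith [pi_pos])
  rw [h34, h1]
  norm_num
  ring

/-- `∫_{D⁺} (5π/6 − √3/4 − u₁/2) du = 5π²/36 − √3π/12 + 1/8` (polar coordinates: the angular
integral over `(π/2 − θ, 5π/6 − θ)` of `ρ(c₀ − ρ cos β/2)` is
`c₀ρπ/3 − (ρ²/2)(sin(5π/6 − θ) − cos θ)` with `cos θ = ρ/2`, `sin θ = √(1 − ρ²/4)`). [folklore] -/
theorem lintegral_Dplus_linear :
    ∫⁻ u in {u : ℝ × ℝ | (u.1 ^ 2 + u.2 ^ 2 < 1 ∧ u.1 ^ 2 + (u.2 - 1) ^ 2 < 1) ∧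
      0 < u.1 ∧ 1 < (u.1 + √3 / 2) ^ 2 + (u.2 - 1 / 2) ^ 2},
      ENNReal.ofReal (5 * π / 6 - √3 / 4 - u.1 / 2) =
    ENNReal.ofReal (5 * π ^ 2 / 36 - √3 * π / 12 + 1 / 8) := by
  have h3 : √3 < 2 := by
    rw [show (2:ℝ) = √4 by rw [show (4:ℝ) = 2 ^ 2 by norm_num, sqrt_sq (by norm_num)]]
    exact sqrt_lt_sqrt (by norm_num) (by norm_num)
  have hc0 : 2 < 5 * π / 6 - √3 / 4 := by nlinarith [pi_gt_three]
  rw [lintegral_Dplus_polar (fun u : ℝ × ℝ => ENNReal.ofReal (5 * π / 6 - √3 / 4 - u.1 / 2))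
    (ENNReal.measurable_ofReal.comp (by fun_prop))]
  have hinner : EqOn (fun ρ : ℝ => ∫⁻ β in Ioo (π / 2 - arccos (ρ / 2)) (5 * π / 6 - arccos (ρ / 2)),
      ENNReal.ofReal ρ * ENNReal.ofReal (5 * π / 6 - √3 / 4 - ρ * cos β / 2))
      (fun ρ => ENNReal.ofReal ((5 * π / 6 - √3 / 4) * (π / 3) * ρ + ρ ^ 3 / 8 -
        √3 / 4 * (ρ ^ 2 * √(1 - ρ ^ 2 / 4)))) (Ioo 0 1) := by
    intro ρ hρ
    dsimp only
    set θ := arccos (ρ / 2) with hθ_def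
    have hcosθ : cos θ = ρ / 2 := cos_arccos (by linarith [hρ.1]) (by linarith [hρ.2])
    have hsinθ : sin θ = √(1 - ρ ^ 2 / 4) := by rw [hθ_def, sin_arccos]; congr 1; ring
    have hθ0 := arccos_nonneg (ρ / 2)
    have hθπ : θ ≤ π / 2 := arccos_le_pi_div_two.mpr (by linarith [hρ.1])
    have hle : π / 2 - θ ≤ 5 * π / 6 - θ := by linarith [pi_pos]
    have hmul : ∀ β : ℝ, ENNReal.ofReal ρ * ENNReal.ofReal (5 * π / 6 - √3 / 4 - ρ * cos β / 2) =
        ENNReal.ofReal (ρ * (5 * π / 6 - √3 / 4) - ρ ^ 2 / 2 * cos β) := by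
      intro β
      rw [← ENNReal.ofReal_mul hρ.1.le]
      congr 1
      ring
    simp only [hmul]
    have hint : IntegrableOn (fun β : ℝ => ρ * (5 * π / 6 - √3 / 4) - ρ ^ 2 / 2 * cos β)
        (Ioo (π / 2 - θ) (5 * π / 6 - θ)) volume :=
      (Continuous.integrableOn_Icc (by fun_prop)).mono_set Ioo_subset_Icc_self
    have hnn : 0 ≤ᵐ[volume.restrict (Ioo (π / 2 - θ) (5 * π / 6 - θ))]
        fun β : ℝ => ρ * (5 * π / 6 - √3 / 4) - ρ ^ 2 / 2 * cos β := by
      filter_upwards with β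
      simp only [Pi.zero_apply]
      nlinarith [cos_le_one β, hρ.1, hρ.2]
    rw [← ofReal_integral_eq_lintegral_ofReal hint hnn, ← integral_Ioc_eq_integral_Ioo,
      ← intervalIntegral.integral_of_le hle, intervalIntegral.integral_sub
      (Continuous.intervalIntegrable (by fun_prop) _ _)
      (Continuous.intervalIntegrable (by fun_prop) _ _),
      intervalIntegral.integral_const, intervalIntegral.integral_const_mul, integral_cos]
    congr 1
    have hs1 : sin (5 * π / 6 - θ) = 1 / 2 * cos θ + √3 / 2 * sin θ := by
      rw [sin_sub, show 5 * π / 6 = π - π / 6 by ring, sin_pi_sub, cos_pi_sub, sin_pi_div_six,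
        cos_pi_div_six]
      ring
    have hs2 : sin (π / 2 - θ) = cos θ := sin_pi_div_two_sub θ
    rw [hs1, hs2, hcosθ, hsinθ, smul_eq_mul]
    ring
  rw [setLIntegral_congr_fun measurableSet_Ioo hinner]
  have hint : IntegrableOn (fun ρ : ℝ => (5 * π / 6 - √3 / 4) * (π / 3) * ρ + ρ ^ 3 / 8 -
      √3 / 4 * (ρ ^ 2 * √(1 - ρ ^ 2 / 4))) (Ioo 0 1) volume :=
    (Continuous.integrableOn_Icc (by fun_prop)).mono_set Ioo_subset_Icc_self
  have hnn : 0 ≤ᵐ[volume.restrict (Ioo (0:ℝ) 1)] fun ρ : ℝ => (5 * π / 6 - √3 / 4) * (π / 3) * ρ +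
      ρ ^ 3 / 8 - √3 / 4 * (ρ ^ 2 * √(1 - ρ ^ 2 / 4)) := by
    filter_upwards [ae_restrict_mem measurableSet_Ioo] with ρ hρ
    have hw : √(1 - ρ ^ 2 / 4) ≤ 1 := sqrt_le_one.mpr (by nlinarith [hρ.1])
    have hw0 : 0 ≤ √(1 - ρ ^ 2 / 4) := sqrt_nonneg _
    have h1 : ρ ^ 2 * √(1 - ρ ^ 2 / 4) ≤ ρ := by
      have : ρ ^ 2 ≤ ρ := by nlinarith [hρ.1, hρ.2]
      nlinarith
    have hX0 : 0 ≤ ρ ^ 2 * √(1 - ρ ^ 2 / 4) := by positivity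
    have h2 : 2 < (5 * π / 6 - √3 / 4) * (π / 3) := by nlinarith [hc0, pi_gt_three]
    have h2' : 2 * ρ ≤ (5 * π / 6 - √3 / 4) * (π / 3) * ρ :=
      mul_le_mul_of_nonneg_right h2.le hρ.1.le
    have h4 : √3 / 4 * (ρ ^ 2 * √(1 - ρ ^ 2 / 4)) ≤ ρ / 2 := by nlinarith [h1, h3, hX0]
    have h5 : 0 ≤ ρ ^ 3 / 8 := div_nonneg (pow_nonneg hρ.1.le 3) (by norm_num)
    simp only [Pi.zero_apply]
    linarith
  rw [← ofReal_integral_eq_lintegral_ofReal hint hnn, ← integral_Ioc_eq_integral_Ioo,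
    ← intervalIntegral.integral_of_le zero_le_one, integral_outer_linear]
  congr 1
  have h33 : √3 ^ 2 = 3 := sq_sqrt (by norm_num)
  linear_combination (1 / 32) * h33


/-!
## Part III-c (appended): the volume of `Wset`

  `volume_wset : vol{(u, v) ∈ V × V : |u − v| < 1} = π²/2 − (3√3/4)π + 1/2`  (`|V| = 2π/3 − √3/2`).

`V × V` is the disjoint union of `Wset`, of the far part `{|u − v| > 1}` and of the null set
`{|u − v| = 1}` (`volume_sphereTie`). By Tonelli the far part has volume `∫_V vol E(u) du`
(`volume_far_eq_lintegral`), `= 2∫_{V⁺} vol E(u) du` by the reflection `u₁ ↦ −u₁`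
(`lintegral_V_eq_two_mul`), `= 2∫_{D⁺} e(u) du` by Lemma E above (`lintegral_Vplus_eq`),
`e(u) = 5π/6 − √3/4 − u₁/2 − A(|u|)/2 − A(|u − (0,1)|)/2`. The two lens terms have equal integrals
over `D⁺` (mirror `u₂ ↦ 1 − u₂`, `mirror_preimage_Dplus`), and Part III-b gives
`∫_{D⁺} e = 1/8 + √3π/24 − π²/36` (`lintegral_Dplus_e`), so the far part has volume
`1/4 + √3π/12 − π²/18` (`volume_far`) and
`vol(Wset) = (2π/3 − √3/2)² − (1/4 + √3π/12 − π²/18) = π²/2 − (3√3/4)π + 1/2`.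
Consequently (`HardDiscStarVolume.volume_starDisc_eq`) the complete star of hard discs has volume
`V(K₄) = 2π · vol(Wset) = π³ − (3√3/2)π² + π`, the value implied by Rowlinson's and Hemmer's
`B₄/B₂³ = 2 − 9√3/(2π) + 10/π²` [ClisbyMccoy2004, §1].
-/

/-! ### The far part of `V × V`: Tonelli and the reflection symmetry -/

/-- The set of pairs `(u, v)` with `v ∈ V` far from `u` (no condition on `u`) is measurable; its
`u`-sections are the far sets `E(u)`. [folklore] -/
theorem measurableSet_far2 : MeasurableSet
    {w : (ℝ × ℝ) × (ℝ × ℝ) | (w.2.1 ^ 2 + w.2.2 ^ 2 < 1 ∧ w.2.1 ^ 2 + (w.2.2 - 1) ^ 2 < 1) ∧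
      1 < (w.1.1 - w.2.1) ^ 2 + (w.1.2 - w.2.2) ^ 2} := by
  simp only [setOf_and]
  exact ((measurableSet_lt (by fun_prop) (by fun_prop)).inter
    (measurableSet_lt (by fun_prop) (by fun_prop))).inter
    (measurableSet_lt (by fun_prop) (by fun_prop))

/-- Measurability of `u ↦ vol E(u)`. [folklore] -/
theorem measurable_volume_farSlice : Measurable fun u : ℝ × ℝ => volume (Prod.mk u ⁻¹'
    {w : (ℝ × ℝ) × (ℝ × ℝ) | (w.2.1 ^ 2 + w.2.2 ^ 2 < 1 ∧ w.2.1 ^ 2 + (w.2.2 - 1) ^ 2 < 1) ∧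
      1 < (w.1.1 - w.2.1) ^ 2 + (w.1.2 - w.2.2) ^ 2}) :=
  measurable_measure_prodMk_left measurableSet_far2

/-- The far part of `V × V` is measurable. [folklore] -/
theorem measurableSet_far : MeasurableSet
    {w : (ℝ × ℝ) × (ℝ × ℝ) | (w.1.1 ^ 2 + w.1.2 ^ 2 < 1 ∧ w.1.1 ^ 2 + (w.1.2 - 1) ^ 2 < 1) ∧
      (w.2.1 ^ 2 + w.2.2 ^ 2 < 1 ∧ w.2.1 ^ 2 + (w.2.2 - 1) ^ 2 < 1) ∧
      1 < (w.1.1 - w.2.1) ^ 2 + (w.1.2 - w.2.2) ^ 2} := by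
  simp only [setOf_and]
  exact ((measurableSet_lt (by fun_prop) (by fun_prop)).inter
    (measurableSet_lt (by fun_prop) (by fun_prop))).inter
    (((measurableSet_lt (by fun_prop) (by fun_prop)).inter
    (measurableSet_lt (by fun_prop) (by fun_prop))).inter
    (measurableSet_lt (by fun_prop) (by fun_prop)))

/-- Tonelli: the volume of the far part of `V × V` is `∫_V vol E(u) du`. [folklore] -/
theorem volume_far_eq_lintegral :
    volume {w : (ℝ × ℝ) × (ℝ × ℝ) | (w.1.1 ^ 2 + w.1.2 ^ 2 < 1 ∧ w.1.1 ^ 2 + (w.1.2 - 1) ^ 2 < 1) ∧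
      (w.2.1 ^ 2 + w.2.2 ^ 2 < 1 ∧ w.2.1 ^ 2 + (w.2.2 - 1) ^ 2 < 1) ∧
      1 < (w.1.1 - w.2.1) ^ 2 + (w.1.2 - w.2.2) ^ 2} =
    ∫⁻ u in {u : ℝ × ℝ | u.1 ^ 2 + u.2 ^ 2 < 1 ∧ u.1 ^ 2 + (u.2 - 1) ^ 2 < 1}, volume (Prod.mk u ⁻¹'
      {w : (ℝ × ℝ) × (ℝ × ℝ) | (w.2.1 ^ 2 + w.2.2 ^ 2 < 1 ∧ w.2.1 ^ 2 + (w.2.2 - 1) ^ 2 < 1) ∧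
      1 < (w.1.1 - w.2.1) ^ 2 + (w.1.2 - w.2.2) ^ 2}) := by
  rw [Measure.volume_eq_prod, Measure.prod_apply measurableSet_far, ← lintegral_indicator]
  · congr 1
    funext u
    simp only [indicator, mem_setOf_eq]
    split_ifs with hu
    · congr 1
      ext v
      simp only [mem_preimage, mem_setOf_eq]
      tauto
    · have : Prod.mk u ⁻¹'
          {w : (ℝ × ℝ) × (ℝ × ℝ) | (w.1.1 ^ 2 + w.1.2 ^ 2 < 1 ∧ w.1.1 ^ 2 + (w.1.2 - 1) ^ 2 < 1) ∧
      (w.2.1 ^ 2 + w.2.2 ^ 2 < 1 ∧ w.2.1 ^ 2 + (w.2.2 - 1) ^ 2 < 1) ∧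
      1 < (w.1.1 - w.2.1) ^ 2 + (w.1.2 - w.2.2) ^ 2} = ∅ := by
        ext v
        simp only [mem_preimage, mem_setOf_eq, mem_empty_iff_false, iff_false, not_and]
        intro h
        exact absurd h hu
      rw [this, measure_empty]
  · simp only [setOf_and]
    exact (measurableSet_lt (by fun_prop) (by fun_prop)).inter
      (measurableSet_lt (by fun_prop) (by fun_prop))

/-- The vertical axis `u₁ = 0` is Lebesgue-null in the plane. [folklore] -/
theorem volume_axis : volume {u : ℝ × ℝ | u.1 = 0} = 0 := by
  have : {u : ℝ × ℝ | u.1 = 0} = ({(0 : ℝ)} : Set ℝ) ×ˢ (univ : Set ℝ) := by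
    ext u; simp
  rw [this, Measure.volume_eq_prod, Measure.prod_prod, Real.volume_singleton, zero_mul]

/-- Reflection symmetry of the slices: `vol E(−u₁, u₂) = vol E(u₁, u₂)`. [folklore] -/
theorem volume_farSlice_reflect (u : ℝ × ℝ) :
    volume (Prod.mk (-u.1, u.2) ⁻¹'
      {w : (ℝ × ℝ) × (ℝ × ℝ) | (w.2.1 ^ 2 + w.2.2 ^ 2 < 1 ∧ w.2.1 ^ 2 + (w.2.2 - 1) ^ 2 < 1) ∧
      1 < (w.1.1 - w.2.1) ^ 2 + (w.1.2 - w.2.2) ^ 2}) =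
    volume (Prod.mk u ⁻¹'
      {w : (ℝ × ℝ) × (ℝ × ℝ) | (w.2.1 ^ 2 + w.2.2 ^ 2 < 1 ∧ w.2.1 ^ 2 + (w.2.2 - 1) ^ 2 < 1) ∧
      1 < (w.1.1 - w.2.1) ^ 2 + (w.1.2 - w.2.2) ^ 2}) := by
  have hpre : Prod.mk (-u.1, u.2) ⁻¹'
      {w : (ℝ × ℝ) × (ℝ × ℝ) | (w.2.1 ^ 2 + w.2.2 ^ 2 < 1 ∧ w.2.1 ^ 2 + (w.2.2 - 1) ^ 2 < 1) ∧
      1 < (w.1.1 - w.2.1) ^ 2 + (w.1.2 - w.2.2) ^ 2} =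
      (fun v : ℝ × ℝ => (-v.1, v.2)) ⁻¹' (Prod.mk u ⁻¹'
      {w : (ℝ × ℝ) × (ℝ × ℝ) | (w.2.1 ^ 2 + w.2.2 ^ 2 < 1 ∧ w.2.1 ^ 2 + (w.2.2 - 1) ^ 2 < 1) ∧
      1 < (w.1.1 - w.2.1) ^ 2 + (w.1.2 - w.2.2) ^ 2}) := by
    ext v
    simp only [mem_preimage, mem_setOf_eq]
    constructor
    · rintro ⟨⟨h0, h1⟩, hf⟩
      exact ⟨⟨by linarith, by linarith⟩, by linarith⟩
    · rintro ⟨⟨h0, h1⟩, hf⟩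
      exact ⟨⟨by linarith, by linarith⟩, by linarith⟩
  rw [hpre, measurePreserving_reflect.measure_preimage
    ((measurable_prodMk_left measurableSet_far2).nullMeasurableSet)]

/-- `∫_V vol E(u) du = 2 ∫_{V⁺} vol E(u) du` (`V⁺ = V ∩ {u₁ > 0}`; the axis is null and the
reflection `u₁ ↦ −u₁` exchanges the two halves). [folklore] -/
theorem lintegral_V_eq_two_mul :
    ∫⁻ u in {u : ℝ × ℝ | u.1 ^ 2 + u.2 ^ 2 < 1 ∧ u.1 ^ 2 + (u.2 - 1) ^ 2 < 1}, volume (Prod.mk u ⁻¹'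
      {w : (ℝ × ℝ) × (ℝ × ℝ) | (w.2.1 ^ 2 + w.2.2 ^ 2 < 1 ∧ w.2.1 ^ 2 + (w.2.2 - 1) ^ 2 < 1) ∧
      1 < (w.1.1 - w.2.1) ^ 2 + (w.1.2 - w.2.2) ^ 2}) =
    2 * ∫⁻ u in {u : ℝ × ℝ | (u.1 ^ 2 + u.2 ^ 2 < 1 ∧ u.1 ^ 2 + (u.2 - 1) ^ 2 < 1) ∧ 0 < u.1},
        volume (Prod.mk u ⁻¹'
      {w : (ℝ × ℝ) × (ℝ × ℝ) | (w.2.1 ^ 2 + w.2.2 ^ 2 < 1 ∧ w.2.1 ^ 2 + (w.2.2 - 1) ^ 2 < 1) ∧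
      1 < (w.1.1 - w.2.1) ^ 2 + (w.1.2 - w.2.2) ^ 2}) := by
  have hVp : MeasurableSet {u : ℝ × ℝ |
      (u.1 ^ 2 + u.2 ^ 2 < 1 ∧ u.1 ^ 2 + (u.2 - 1) ^ 2 < 1) ∧ 0 < u.1} := by
    simp only [setOf_and]
    exact ((measurableSet_lt (by fun_prop) (by fun_prop)).inter
      (measurableSet_lt (by fun_prop) (by fun_prop))).inter
      (measurableSet_lt (by fun_prop) (by fun_prop))
  have hVm : MeasurableSet {u : ℝ × ℝ |
      (u.1 ^ 2 + u.2 ^ 2 < 1 ∧ u.1 ^ 2 + (u.2 - 1) ^ 2 < 1) ∧ u.1 < 0} := by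
    simp only [setOf_and]
    exact ((measurableSet_lt (by fun_prop) (by fun_prop)).inter
      (measurableSet_lt (by fun_prop) (by fun_prop))).inter
      (measurableSet_lt (by fun_prop) (by fun_prop))
  -- `V = V⁺ ∪ V⁻` up to the null axis
  have hae : {u : ℝ × ℝ | u.1 ^ 2 + u.2 ^ 2 < 1 ∧ u.1 ^ 2 + (u.2 - 1) ^ 2 < 1} =ᵐ[volume]
      ({u : ℝ × ℝ | (u.1 ^ 2 + u.2 ^ 2 < 1 ∧ u.1 ^ 2 + (u.2 - 1) ^ 2 < 1) ∧ 0 < u.1} ∪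
       {u : ℝ × ℝ |
           (u.1 ^ 2 + u.2 ^ 2 < 1 ∧ u.1 ^ 2 + (u.2 - 1) ^ 2 < 1) ∧ u.1 < 0} : Set (ℝ × ℝ)) := by
    refine ae_eq_set.mpr ⟨?_, ?_⟩
    · refine measure_mono_null ?_ volume_axis
      rintro u ⟨hu, hnot⟩
      simp only [mem_union, mem_setOf_eq, not_or, not_and, not_lt] at hnot
      have h1 := hnot.1 hu
      have h2 := hnot.2 hu
      simp only [mem_setOf_eq]
      linarith
    · refine measure_mono_null (fun u hu => ?_) (measure_empty (μ := (volume : Measure (ℝ × ℝ))))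
      exact (hu.2 (by rcases hu.1 with ⟨hv, -⟩ | ⟨hv, -⟩ <;> exact hv)).elim
  have hdisj : Disjoint {u : ℝ × ℝ |
      (u.1 ^ 2 + u.2 ^ 2 < 1 ∧ u.1 ^ 2 + (u.2 - 1) ^ 2 < 1) ∧ 0 < u.1}
      {u : ℝ × ℝ | (u.1 ^ 2 + u.2 ^ 2 < 1 ∧ u.1 ^ 2 + (u.2 - 1) ^ 2 < 1) ∧ u.1 < 0} :=
    Set.disjoint_left.mpr (fun u h1 h2 => by
      simp only [mem_setOf_eq] at h1 h2; linarith [h1.2, h2.2])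
  rw [setLIntegral_congr hae, lintegral_union hVm hdisj]
  -- the integral over `V⁻` equals the one over `V⁺`
  have hpre : (fun v : ℝ × ℝ => (-v.1, v.2)) ⁻¹'
      {u : ℝ × ℝ | (u.1 ^ 2 + u.2 ^ 2 < 1 ∧ u.1 ^ 2 + (u.2 - 1) ^ 2 < 1) ∧ u.1 < 0} =
      {u : ℝ × ℝ | (u.1 ^ 2 + u.2 ^ 2 < 1 ∧ u.1 ^ 2 + (u.2 - 1) ^ 2 < 1) ∧ 0 < u.1} := by
    ext u
    simp only [mem_preimage, mem_setOf_eq]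
    constructor
    · rintro ⟨⟨h0, h1⟩, hf⟩
      exact ⟨⟨by linarith, by linarith⟩, by linarith⟩
    · rintro ⟨⟨h0, h1⟩, hf⟩
      exact ⟨⟨by linarith, by linarith⟩, by linarith⟩
  have key := measurePreserving_reflect.setLIntegral_comp_preimage hVm
    measurable_volume_farSlice
  rw [hpre] at key
  simp only [volume_farSlice_reflect] at key
  rw [← key, two_mul]

/-- On `V⁺` the slice volume is `vol E(u) = e(u) · 𝟙(u far from the tip)`, so
`∫_{V⁺} vol E(u) = ∫_{D⁺} e`. [folklore] -/
theorem lintegral_Vplus_eq :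
    ∫⁻ u in {u : ℝ × ℝ | (u.1 ^ 2 + u.2 ^ 2 < 1 ∧ u.1 ^ 2 + (u.2 - 1) ^ 2 < 1) ∧ 0 < u.1},
        volume (Prod.mk u ⁻¹'
      {w : (ℝ × ℝ) × (ℝ × ℝ) | (w.2.1 ^ 2 + w.2.2 ^ 2 < 1 ∧ w.2.1 ^ 2 + (w.2.2 - 1) ^ 2 < 1) ∧
      1 < (w.1.1 - w.2.1) ^ 2 + (w.1.2 - w.2.2) ^ 2}) =
    ∫⁻ u in {u : ℝ × ℝ | (u.1 ^ 2 + u.2 ^ 2 < 1 ∧ u.1 ^ 2 + (u.2 - 1) ^ 2 < 1) ∧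
      0 < u.1 ∧ 1 < (u.1 + √3 / 2) ^ 2 + (u.2 - 1 / 2) ^ 2},
      ENNReal.ofReal (5 * π / 6 - √3 / 4 - u.1 / 2 -
        (2 * arccos (√(u.1 ^ 2 + u.2 ^ 2) / 2) -
          √(u.1 ^ 2 + u.2 ^ 2) * √(1 - √(u.1 ^ 2 + u.2 ^ 2) ^ 2 / 4)) / 2 -
        (2 * arccos (√(u.1 ^ 2 + (u.2 - 1) ^ 2) / 2) -
          √(u.1 ^ 2 + (u.2 - 1) ^ 2) * √(1 - √(u.1 ^ 2 + (u.2 - 1) ^ 2) ^ 2 / 4)) / 2) := by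
  have hVp : MeasurableSet {u : ℝ × ℝ |
      (u.1 ^ 2 + u.2 ^ 2 < 1 ∧ u.1 ^ 2 + (u.2 - 1) ^ 2 < 1) ∧ 0 < u.1} := by
    simp only [setOf_and]
    exact ((measurableSet_lt (by fun_prop) (by fun_prop)).inter
      (measurableSet_lt (by fun_prop) (by fun_prop))).inter
      (measurableSet_lt (by fun_prop) (by fun_prop))
  have hfar : MeasurableSet {u : ℝ × ℝ | 1 < (u.1 + √3 / 2) ^ 2 + (u.2 - 1 / 2) ^ 2} :=
    measurableSet_lt (by fun_prop) (by fun_prop)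
  have hD : {u : ℝ × ℝ | (u.1 ^ 2 + u.2 ^ 2 < 1 ∧ u.1 ^ 2 + (u.2 - 1) ^ 2 < 1) ∧
      0 < u.1 ∧ 1 < (u.1 + √3 / 2) ^ 2 + (u.2 - 1 / 2) ^ 2} =
      {u : ℝ × ℝ | 1 < (u.1 + √3 / 2) ^ 2 + (u.2 - 1 / 2) ^ 2} ∩
      {u : ℝ × ℝ | (u.1 ^ 2 + u.2 ^ 2 < 1 ∧ u.1 ^ 2 + (u.2 - 1) ^ 2 < 1) ∧ 0 < u.1} := by
    ext u; simp only [mem_setOf_eq, mem_inter_iff]; tauto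
  rw [hD, ← Measure.restrict_restrict hfar, ← lintegral_indicator hfar]
  refine setLIntegral_congr_fun hVp (fun u hu => ?_)
  simp only [indicator, mem_setOf_eq]
  split_ifs with hf
  · exact (volume_farSlice_far hu.2 hu.1.1 hu.1.2 hf).1
  · exact volume_farSlice_near hu.2.le hu.1.1 hu.1.2 (not_lt.mp hf)

/-- `D⁺` is symmetric under the mirror `(u₁, u₂) ↦ (u₁, 1 − u₂)`. [folklore] -/
theorem mirror_preimage_Dplus : (fun v : ℝ × ℝ => (v.1, 1 - v.2)) ⁻¹'
    {u : ℝ × ℝ | (u.1 ^ 2 + u.2 ^ 2 < 1 ∧ u.1 ^ 2 + (u.2 - 1) ^ 2 < 1) ∧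
      0 < u.1 ∧ 1 < (u.1 + √3 / 2) ^ 2 + (u.2 - 1 / 2) ^ 2} =
    {u : ℝ × ℝ | (u.1 ^ 2 + u.2 ^ 2 < 1 ∧ u.1 ^ 2 + (u.2 - 1) ^ 2 < 1) ∧
      0 < u.1 ∧ 1 < (u.1 + √3 / 2) ^ 2 + (u.2 - 1 / 2) ^ 2} := by
  ext u
  simp only [mem_preimage, mem_setOf_eq]
  constructor
  · rintro ⟨⟨h0, h1⟩, hp, hf⟩
    exact ⟨⟨by linarith, by linarith⟩, hp, by linarith⟩
  · rintro ⟨⟨h0, h1⟩, hp, hf⟩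
    exact ⟨⟨by linarith, by linarith⟩, hp, by linarith⟩

/-- **The key integral**: `∫_{D⁺} e = 1/8 + √3π/24 − π²/36`, where
`e(u) = 5π/6 − √3/4 − u₁/2 − A(|u|)/2 − A(|u − (0,1)|)/2` is the area of the far set `E(u)`:
the two lens terms have the same integral (mirror symmetry of `D⁺`), and the remaining two
integrals are `lintegral_Dplus_linear`, `lintegral_Dplus_halfLensArea`. [folklore] -/
theorem lintegral_Dplus_e :
    ∫⁻ u in {u : ℝ × ℝ | (u.1 ^ 2 + u.2 ^ 2 < 1 ∧ u.1 ^ 2 + (u.2 - 1) ^ 2 < 1) ∧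
      0 < u.1 ∧ 1 < (u.1 + √3 / 2) ^ 2 + (u.2 - 1 / 2) ^ 2},
      ENNReal.ofReal (5 * π / 6 - √3 / 4 - u.1 / 2 -
        (2 * arccos (√(u.1 ^ 2 + u.2 ^ 2) / 2) -
          √(u.1 ^ 2 + u.2 ^ 2) * √(1 - √(u.1 ^ 2 + u.2 ^ 2) ^ 2 / 4)) / 2 -
        (2 * arccos (√(u.1 ^ 2 + (u.2 - 1) ^ 2) / 2) -
          √(u.1 ^ 2 + (u.2 - 1) ^ 2) * √(1 - √(u.1 ^ 2 + (u.2 - 1) ^ 2) ^ 2 / 4)) / 2) =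
    ENNReal.ofReal (1 / 8 + √3 * π / 24 - π ^ 2 / 36) := by
  -- integrability of continuous functions on the bounded set `D⁺`
  have hK : IsCompact (Icc (-1:ℝ) 1 ×ˢ Icc (-1:ℝ) 1) := isCompact_Icc.prod isCompact_Icc
  have hsub : {u : ℝ × ℝ | (u.1 ^ 2 + u.2 ^ 2 < 1 ∧ u.1 ^ 2 + (u.2 - 1) ^ 2 < 1) ∧
      0 < u.1 ∧ 1 < (u.1 + √3 / 2) ^ 2 + (u.2 - 1 / 2) ^ 2} ⊆
      Icc (-1:ℝ) 1 ×ˢ Icc (-1:ℝ) 1 := by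
    rintro u ⟨⟨h0, -⟩, -, -⟩
    have a1 := abs_lt.mp ((sq_lt_one_iff_abs_lt_one u.1).mp (by nlinarith [sq_nonneg u.2]))
    have a2 := abs_lt.mp ((sq_lt_one_iff_abs_lt_one u.2).mp (by nlinarith [sq_nonneg u.1]))
    exact ⟨⟨a1.1.le, a1.2.le⟩, ⟨a2.1.le, a2.2.le⟩⟩
  have hint : ∀ f : ℝ × ℝ → ℝ, Continuous f → IntegrableOn f
      {u : ℝ × ℝ | (u.1 ^ 2 + u.2 ^ 2 < 1 ∧ u.1 ^ 2 + (u.2 - 1) ^ 2 < 1) ∧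
      0 < u.1 ∧ 1 < (u.1 + √3 / 2) ^ 2 + (u.2 - 1 / 2) ^ 2} volume :=
    fun f hf => (hf.continuousOn.integrableOn_compact hK).mono_set hsub
  have hlens0 : ∀ u ∈ {u : ℝ × ℝ | (u.1 ^ 2 + u.2 ^ 2 < 1 ∧ u.1 ^ 2 + (u.2 - 1) ^ 2 < 1) ∧
      0 < u.1 ∧ 1 < (u.1 + √3 / 2) ^ 2 + (u.2 - 1 / 2) ^ 2},
      0 ≤ (2 * arccos (√(u.1 ^ 2 + u.2 ^ 2) / 2) -
          √(u.1 ^ 2 + u.2 ^ 2) * √(1 - √(u.1 ^ 2 + u.2 ^ 2) ^ 2 / 4)) / 2 := by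
    rintro u ⟨⟨h0, -⟩, -, -⟩
    have hρ1 : √(u.1 ^ 2 + u.2 ^ 2) ≤ 1 := sqrt_le_one.mpr h0.le
    linarith [(HardDiscTriangleVolume.volume_lens (sqrt_nonneg (u.1 ^ 2 + u.2 ^ 2)) hρ1).2]
  -- pass to the Bochner integral
  have hnn : 0 ≤ᵐ[volume.restrict {u : ℝ × ℝ |
      (u.1 ^ 2 + u.2 ^ 2 < 1 ∧ u.1 ^ 2 + (u.2 - 1) ^ 2 < 1) ∧
      0 < u.1 ∧ 1 < (u.1 + √3 / 2) ^ 2 + (u.2 - 1 / 2) ^ 2}]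
      fun u : ℝ × ℝ => (5 * π / 6 - √3 / 4 - u.1 / 2 -
        (2 * arccos (√(u.1 ^ 2 + u.2 ^ 2) / 2) -
          √(u.1 ^ 2 + u.2 ^ 2) * √(1 - √(u.1 ^ 2 + u.2 ^ 2) ^ 2 / 4)) / 2 -
        (2 * arccos (√(u.1 ^ 2 + (u.2 - 1) ^ 2) / 2) -
          √(u.1 ^ 2 + (u.2 - 1) ^ 2) * √(1 - √(u.1 ^ 2 + (u.2 - 1) ^ 2) ^ 2 / 4)) / 2) := by
    filter_upwards [ae_restrict_mem measurableSet_Dplus] with u hu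
    exact (volume_farSlice_far hu.2.1 hu.1.1 hu.1.2 hu.2.2).2
  rw [← ofReal_integral_eq_lintegral_ofReal (hint _ (by fun_prop)) hnn]
  congr 1
  -- split into the three terms
  rw [integral_sub (hint (fun u : ℝ × ℝ => 5 * π / 6 - √3 / 4 - u.1 / 2 -
      (2 * arccos (√(u.1 ^ 2 + u.2 ^ 2) / 2) -
        √(u.1 ^ 2 + u.2 ^ 2) * √(1 - √(u.1 ^ 2 + u.2 ^ 2) ^ 2 / 4)) / 2) (by fun_prop))
      (hint _ (by fun_prop)),
    integral_sub (hint _ (by fun_prop)) (hint _ (by fun_prop))]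
  -- (1) the linear term
  have h1 : ∫ u in {u : ℝ × ℝ | (u.1 ^ 2 + u.2 ^ 2 < 1 ∧ u.1 ^ 2 + (u.2 - 1) ^ 2 < 1) ∧
      0 < u.1 ∧ 1 < (u.1 + √3 / 2) ^ 2 + (u.2 - 1 / 2) ^ 2},
      (5 * π / 6 - √3 / 4 - u.1 / 2) = 5 * π ^ 2 / 36 - √3 * π / 12 + 1 / 8 := by
    rw [integral_eq_lintegral_of_nonneg_ae, lintegral_Dplus_linear, ENNReal.toReal_ofReal]
    · have h3 : √3 < 2 := by
        rw [show (2:ℝ) = √4 by rw [show (4:ℝ) = 2 ^ 2 by norm_num, sqrt_sq (by norm_num)]]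
        exact sqrt_lt_sqrt (by norm_num) (by norm_num)
      nlinarith [pi_gt_three]
    · filter_upwards [ae_restrict_mem measurableSet_Dplus] with u hu
      obtain ⟨⟨h0, -⟩, -, -⟩ := hu
      have a1 := abs_lt.mp ((sq_lt_one_iff_abs_lt_one u.1).mp (by nlinarith [sq_nonneg u.2]))
      have h3 : √3 < 2 := by
        rw [show (2:ℝ) = √4 by rw [show (4:ℝ) = 2 ^ 2 by norm_num, sqrt_sq (by norm_num)]]
        exact sqrt_lt_sqrt (by norm_num) (by norm_num)
      simp only [Pi.zero_apply]
      nlinarith [pi_gt_three, a1.2]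
    · exact (Continuous.aestronglyMeasurable (by fun_prop)).restrict
  -- (2) the first lens term
  have h2 : ∫ u in {u : ℝ × ℝ | (u.1 ^ 2 + u.2 ^ 2 < 1 ∧ u.1 ^ 2 + (u.2 - 1) ^ 2 < 1) ∧
      0 < u.1 ∧ 1 < (u.1 + √3 / 2) ^ 2 + (u.2 - 1 / 2) ^ 2},
      (2 * arccos (√(u.1 ^ 2 + u.2 ^ 2) / 2) -
          √(u.1 ^ 2 + u.2 ^ 2) * √(1 - √(u.1 ^ 2 + u.2 ^ 2) ^ 2 / 4)) / 2
              = π / 6 * (π / 2 - 3 * √3 / 8) := by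
    rw [integral_eq_lintegral_of_nonneg_ae, lintegral_Dplus_halfLensArea, ENNReal.toReal_ofReal]
    · have h3 : √3 < 2 := by
        rw [show (2:ℝ) = √4 by rw [show (4:ℝ) = 2 ^ 2 by norm_num, sqrt_sq (by norm_num)]]
        exact sqrt_lt_sqrt (by norm_num) (by norm_num)
      nlinarith [pi_gt_three]
    · filter_upwards [ae_restrict_mem measurableSet_Dplus] with u hu
      simp only [Pi.zero_apply]
      exact hlens0 u hu
    · exact (Continuous.aestronglyMeasurable (by fun_prop)).restrict
  -- (3) the second lens term equals the first (mirror symmetry)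
  have h3 : ∫ u in {u : ℝ × ℝ | (u.1 ^ 2 + u.2 ^ 2 < 1 ∧ u.1 ^ 2 + (u.2 - 1) ^ 2 < 1) ∧
      0 < u.1 ∧ 1 < (u.1 + √3 / 2) ^ 2 + (u.2 - 1 / 2) ^ 2},
      (2 * arccos (√(u.1 ^ 2 + (u.2 - 1) ^ 2) / 2) -
          √(u.1 ^ 2 + (u.2 - 1) ^ 2) * √(1 - √(u.1 ^ 2 + (u.2 - 1) ^ 2) ^ 2 / 4)) / 2
              = π / 6 * (π / 2 - 3 * √3 / 8) := by
    have hemb : MeasurableEmbedding (fun v : ℝ × ℝ => (v.1, 1 - v.2)) :=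
      ((MeasurableEquiv.refl ℝ).prodCongr (MeasurableEquiv.subLeft (1:ℝ))).measurableEmbedding
    have key := measurePreserving_mirror.setIntegral_preimage_emb hemb
      (fun u : ℝ × ℝ => (2 * arccos (√(u.1 ^ 2 + u.2 ^ 2) / 2) -
          √(u.1 ^ 2 + u.2 ^ 2) * √(1 - √(u.1 ^ 2 + u.2 ^ 2) ^ 2 / 4)) / 2)
      {u : ℝ × ℝ | (u.1 ^ 2 + u.2 ^ 2 < 1 ∧ u.1 ^ 2 + (u.2 - 1) ^ 2 < 1) ∧
      0 < u.1 ∧ 1 < (u.1 + √3 / 2) ^ 2 + (u.2 - 1 / 2) ^ 2}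
    rw [mirror_preimage_Dplus] at key
    have hsq : ∀ u : ℝ × ℝ, u.1 ^ 2 + (1 - u.2) ^ 2 = u.1 ^ 2 + (u.2 - 1) ^ 2 := fun u => by ring
    simp only [hsq] at key
    rw [key, h2]
  rw [h1, h2, h3]
  ring

/-- **Volume of the far part of `V × V`**: `vol{(u,v) ∈ V² : |u − v| > 1} = 1/4 + √3π/12 − π²/18`.
[folklore] -/
theorem volume_far :
    volume {w : (ℝ × ℝ) × (ℝ × ℝ) | (w.1.1 ^ 2 + w.1.2 ^ 2 < 1 ∧ w.1.1 ^ 2 + (w.1.2 - 1) ^ 2 < 1) ∧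
      (w.2.1 ^ 2 + w.2.2 ^ 2 < 1 ∧ w.2.1 ^ 2 + (w.2.2 - 1) ^ 2 < 1) ∧
      1 < (w.1.1 - w.2.1) ^ 2 + (w.1.2 - w.2.2) ^ 2} =
    ENNReal.ofReal (1 / 4 + √3 * π / 12 - π ^ 2 / 18) := by
  rw [volume_far_eq_lintegral, lintegral_V_eq_two_mul, lintegral_Vplus_eq, lintegral_Dplus_e,
    show (2 : ENNReal) = ENNReal.ofReal 2 by simp, ← ENNReal.ofReal_mul (by norm_num)]
  congr 1
  ring

/-- For `v ∈ ℝ × ℝ` fixed, the set of `s` with `(s − v₁)² = 1 − (t − v₂)²` has at most two points,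
so the "unit-distance" set in `V × V` is null (Tonelli). [folklore] -/
theorem volume_sphereTie : volume
    {w : (ℝ × ℝ) × (ℝ × ℝ) | (w.1.1 ^ 2 + w.1.2 ^ 2 < 1 ∧ w.1.1 ^ 2 + (w.1.2 - 1) ^ 2 < 1) ∧
      (w.2.1 ^ 2 + w.2.2 ^ 2 < 1 ∧ w.2.1 ^ 2 + (w.2.2 - 1) ^ 2 < 1) ∧
      (w.1.1 - w.2.1) ^ 2 + (w.1.2 - w.2.2) ^ 2 = 1} = 0 := by
  have hS : MeasurableSet {c : (ℝ × ℝ) × (ℝ × ℝ) |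
      (c.1.1 - c.2.1) ^ 2 = 1 - (c.1.2 - c.2.2) ^ 2} :=
    measurableSet_eq_fun (by fun_prop) (by fun_prop)
  refine measure_mono_null
    (t := {c : (ℝ × ℝ) × (ℝ × ℝ) | (c.1.1 - c.2.1) ^ 2 = 1 - (c.1.2 - c.2.2) ^ 2})
    (fun w hw => ?_) ?_
  · simp only [mem_setOf_eq] at hw ⊢
    linarith [hw.2.2]
  · rw [Measure.volume_eq_prod, Measure.prod_apply_symm hS]
    refine (lintegral_eq_zero_iff' (Measurable.aemeasurable ?_)).mpr ?_
    · exact measurable_measure_prodMk_right hS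
    · filter_upwards with v
      simp only [Pi.zero_apply]
      have hS' : MeasurableSet ((fun x : ℝ × ℝ => (x, v)) ⁻¹'
          {c : (ℝ × ℝ) × (ℝ × ℝ) | (c.1.1 - c.2.1) ^ 2 = 1 - (c.1.2 - c.2.2) ^ 2}) :=
        measurable_prodMk_right hS
      rw [Measure.volume_eq_prod, Measure.prod_apply_symm hS']
      refine (lintegral_eq_zero_iff' (Measurable.aemeasurable ?_)).mpr ?_
      · exact measurable_measure_prodMk_right hS'
      · filter_upwards with t
        simp only [Pi.zero_apply]
        refine measure_mono_null (t := {v.1 + √(1 - (t - v.2) ^ 2), v.1 - √(1 - (t - v.2) ^ 2)}) ?_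
          (((Set.finite_singleton _).insert _).measure_zero _)
        intro s hs
        simp only [mem_preimage, mem_setOf_eq] at hs
        have habs : |s - v.1| = √(1 - (t - v.2) ^ 2) := by rw [← Real.sqrt_sq_eq_abs, hs]
        simp only [mem_insert_iff, mem_singleton_iff]
        rcases (abs_eq (sqrt_nonneg _)).mp habs with h1 | h1
        · left; linarith
        · right; linarith

/-- **Volume of `Wset`**: `vol{(u, v) ∈ V × V : |u − v| < 1} = π²/2 − (3√3/4)π + 1/2`
(`= |V|² − vol(far part)`, `|V| = 2π/3 − √3/2`). [folklore] -/
theorem volume_wset :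
    volume {w : (ℝ × ℝ) × (ℝ × ℝ) | w.1.1 ^ 2 + w.1.2 ^ 2 < 1 ∧ w.1.1 ^ 2 + (w.1.2 - 1) ^ 2 < 1 ∧
      w.2.1 ^ 2 + w.2.2 ^ 2 < 1 ∧ w.2.1 ^ 2 + (w.2.2 - 1) ^ 2 < 1 ∧
      (w.1.1 - w.2.1) ^ 2 + (w.1.2 - w.2.2) ^ 2 < 1} =
    ENNReal.ofReal (π ^ 2 / 2 - 3 * √3 * π / 4 + 1 / 2) := by
  -- `|V|`
  have hV : volume {u : ℝ × ℝ | u.1 ^ 2 + u.2 ^ 2 < 1 ∧ u.1 ^ 2 + (u.2 - 1) ^ 2 < 1} =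
      ENNReal.ofReal (2 * π / 3 - √3 / 2) := by
    rw [(HardDiscTriangleVolume.volume_lens zero_le_one le_rfl).1]
    congr 1
    have h4 : √(4:ℝ) = 2 := by
      rw [show (4:ℝ) = 2 ^ 2 by norm_num, Real.sqrt_sq (by norm_num)]
    have h34 : √(1 - 1 ^ 2 / 4 : ℝ) = √3 / 2 := by
      rw [show (1 - 1 ^ 2 / 4 : ℝ) = 3 / 4 by norm_num, Real.sqrt_div (by norm_num), h4]
    have h1 : arccos ((1:ℝ) / 2) = π / 3 := by
      rw [show (1:ℝ) / 2 = cos (π / 3) by rw [cos_pi_div_three], arccos_cos (by positivity)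
        (by linarith [pi_pos])]
    rw [h34, h1]
    ring
  have hVV : volume {w : (ℝ × ℝ) × (ℝ × ℝ) |
      (w.1.1 ^ 2 + w.1.2 ^ 2 < 1 ∧ w.1.1 ^ 2 + (w.1.2 - 1) ^ 2 < 1) ∧
      (w.2.1 ^ 2 + w.2.2 ^ 2 < 1 ∧ w.2.1 ^ 2 + (w.2.2 - 1) ^ 2 < 1)} =
      ENNReal.ofReal (2 * π / 3 - √3 / 2) * ENNReal.ofReal (2 * π / 3 - √3 / 2) := by
    rw [show {w : (ℝ × ℝ) × (ℝ × ℝ) |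
        (w.1.1 ^ 2 + w.1.2 ^ 2 < 1 ∧ w.1.1 ^ 2 + (w.1.2 - 1) ^ 2 < 1) ∧
      (w.2.1 ^ 2 + w.2.2 ^ 2 < 1 ∧ w.2.1 ^ 2 + (w.2.2 - 1) ^ 2 < 1)} =
        {u : ℝ × ℝ | u.1 ^ 2 + u.2 ^ 2 < 1 ∧ u.1 ^ 2 + (u.2 - 1) ^ 2 < 1} ×ˢ
        {u : ℝ × ℝ | u.1 ^ 2 + u.2 ^ 2 < 1 ∧ u.1 ^ 2 + (u.2 - 1) ^ 2 < 1} by ext w; simp [mem_prod],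
      Measure.volume_eq_prod, Measure.prod_prod, hV]
  -- `V × V = Wset ∪ far ∪ (null)`
  have hWm : MeasurableSet {w : (ℝ × ℝ) × (ℝ × ℝ) |
      w.1.1 ^ 2 + w.1.2 ^ 2 < 1 ∧ w.1.1 ^ 2 + (w.1.2 - 1) ^ 2 < 1 ∧
      w.2.1 ^ 2 + w.2.2 ^ 2 < 1 ∧ w.2.1 ^ 2 + (w.2.2 - 1) ^ 2 < 1 ∧
      (w.1.1 - w.2.1) ^ 2 + (w.1.2 - w.2.2) ^ 2 < 1} := by
    simp only [setOf_and]
    refine MeasurableSet.inter ?_ (MeasurableSet.inter ?_ (MeasurableSet.inter ?_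
      (MeasurableSet.inter ?_ ?_))) <;>
      exact measurableSet_lt (by fun_prop) (by fun_prop)
  have hsub : {w : (ℝ × ℝ) × (ℝ × ℝ) | w.1.1 ^ 2 + w.1.2 ^ 2 < 1 ∧ w.1.1 ^ 2 + (w.1.2 - 1) ^ 2 < 1 ∧
      w.2.1 ^ 2 + w.2.2 ^ 2 < 1 ∧ w.2.1 ^ 2 + (w.2.2 - 1) ^ 2 < 1 ∧
      (w.1.1 - w.2.1) ^ 2 + (w.1.2 - w.2.2) ^ 2 < 1} ∪
      {w : (ℝ × ℝ) × (ℝ × ℝ) | (w.1.1 ^ 2 + w.1.2 ^ 2 < 1 ∧ w.1.1 ^ 2 + (w.1.2 - 1) ^ 2 < 1) ∧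
      (w.2.1 ^ 2 + w.2.2 ^ 2 < 1 ∧ w.2.1 ^ 2 + (w.2.2 - 1) ^ 2 < 1) ∧
      1 < (w.1.1 - w.2.1) ^ 2 + (w.1.2 - w.2.2) ^ 2} ⊆
      {w : (ℝ × ℝ) × (ℝ × ℝ) | (w.1.1 ^ 2 + w.1.2 ^ 2 < 1 ∧ w.1.1 ^ 2 + (w.1.2 - 1) ^ 2 < 1) ∧
      (w.2.1 ^ 2 + w.2.2 ^ 2 < 1 ∧ w.2.1 ^ 2 + (w.2.2 - 1) ^ 2 < 1)} := by
    rintro w (⟨h1, h2, h3, h4, -⟩ | ⟨hw1, hw2, -⟩)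
    · exact ⟨⟨h1, h2⟩, ⟨h3, h4⟩⟩
    · exact ⟨hw1, hw2⟩
  have hnull : volume ({w : (ℝ × ℝ) × (ℝ × ℝ) |
      (w.1.1 ^ 2 + w.1.2 ^ 2 < 1 ∧ w.1.1 ^ 2 + (w.1.2 - 1) ^ 2 < 1) ∧
      (w.2.1 ^ 2 + w.2.2 ^ 2 < 1 ∧ w.2.1 ^ 2 + (w.2.2 - 1) ^ 2 < 1)} \
      ({w : (ℝ × ℝ) × (ℝ × ℝ) | w.1.1 ^ 2 + w.1.2 ^ 2 < 1 ∧ w.1.1 ^ 2 + (w.1.2 - 1) ^ 2 < 1 ∧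
      w.2.1 ^ 2 + w.2.2 ^ 2 < 1 ∧ w.2.1 ^ 2 + (w.2.2 - 1) ^ 2 < 1 ∧
      (w.1.1 - w.2.1) ^ 2 + (w.1.2 - w.2.2) ^ 2 < 1} ∪
      {w : (ℝ × ℝ) × (ℝ × ℝ) | (w.1.1 ^ 2 + w.1.2 ^ 2 < 1 ∧ w.1.1 ^ 2 + (w.1.2 - 1) ^ 2 < 1) ∧
      (w.2.1 ^ 2 + w.2.2 ^ 2 < 1 ∧ w.2.1 ^ 2 + (w.2.2 - 1) ^ 2 < 1) ∧
      1 < (w.1.1 - w.2.1) ^ 2 + (w.1.2 - w.2.2) ^ 2})) = 0 := by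
    refine measure_mono_null ?_ volume_sphereTie
    rintro w ⟨⟨hw1, hw2⟩, hnot⟩
    simp only [mem_union, mem_setOf_eq, not_or, not_and, not_lt] at hnot
    refine ⟨hw1, hw2, le_antisymm (hnot.2 hw1 hw2) ?_⟩
    have := hnot.1 hw1.1 hw1.2 hw2.1 hw2.2
    exact this
  have hdisj : Disjoint {w : (ℝ × ℝ) × (ℝ × ℝ) |
      w.1.1 ^ 2 + w.1.2 ^ 2 < 1 ∧ w.1.1 ^ 2 + (w.1.2 - 1) ^ 2 < 1 ∧
      w.2.1 ^ 2 + w.2.2 ^ 2 < 1 ∧ w.2.1 ^ 2 + (w.2.2 - 1) ^ 2 < 1 ∧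
      (w.1.1 - w.2.1) ^ 2 + (w.1.2 - w.2.2) ^ 2 < 1}
      {w : (ℝ × ℝ) × (ℝ × ℝ) | (w.1.1 ^ 2 + w.1.2 ^ 2 < 1 ∧ w.1.1 ^ 2 + (w.1.2 - 1) ^ 2 < 1) ∧
      (w.2.1 ^ 2 + w.2.2 ^ 2 < 1 ∧ w.2.1 ^ 2 + (w.2.2 - 1) ^ 2 < 1) ∧
      1 < (w.1.1 - w.2.1) ^ 2 + (w.1.2 - w.2.2) ^ 2} :=
    Set.disjoint_left.mpr (fun w h1 h2 => by
      simp only [mem_setOf_eq] at h1 h2; linarith [h1.2.2.2.2, h2.2.2])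
  have hdecomp := measure_eq_measure_of_null_sdiff hsub hnull
  rw [measure_union hdisj measurableSet_far, hVV, volume_far] at hdecomp
  have hfin : ENNReal.ofReal (1 / 4 + √3 * π / 12 - π ^ 2 / 18) ≠ ⊤ := ENNReal.ofReal_ne_top
  rw [ENNReal.eq_sub_of_add_eq hfin hdecomp, ← ENNReal.ofReal_mul (by
      have h3 : √3 < 2 := by
        rw [show (2:ℝ) = √4 by rw [show (4:ℝ) = 2 ^ 2 by norm_num, sqrt_sq (by norm_num)]]
        exact sqrt_lt_sqrt (by norm_num) (by norm_num)
      nlinarith [pi_gt_three]),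
    ← ENNReal.ofReal_sub _ (by
      have h3 : (173 : ℝ) / 100 < √3 := by
        rw [show (173 : ℝ) / 100 = √((173 / 100) ^ 2) by rw [sqrt_sq (by norm_num)]]
        exact sqrt_lt_sqrt (by norm_num) (by norm_num)
      nlinarith [pi_gt_three, pi_lt_d2])]
  congr 1
  have h33 : √3 ^ 2 = 3 := sq_sqrt (by norm_num)
  linear_combination (1 / 4) * h33

end HardDiscStarLens

end Literature.MathematicalPhysics.StatisticalMechanics

end
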